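import Literature.Analysis.FluidPDE.OnsagerBDSVEnergy
import Literature.Analysis.FluidPDE.OnsagerBDSVCorrectorBounds
import Literature.Analysis.FluidPDE.OnsagerBDSVEnergyCrossTerm
import Literature.Analysis.FluidPDE.OnsagerBDSVEnergyCorrector
import Literature.Analysis.FluidPDE.OnsagerBDSVEnergyCorrectorHolds
import Literature.Analysis.FluidPDE.OnsagerBDSVCorrectorBoundsProofs
import Literature.Analysis.FluidPDE.DeRosaPertTransport
import Literature.Analysis.FluidPDE.DeRosaPerturbation
import HarnessLib

/-!
# De Rosa's perturbation stage: the corrector `w_c` and the cross and corrector terms of the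
# energy (Props. 5.11–5.12) under the core hypotheses — port of the BDSV proofs

L. De Rosa, *Infinitely many Leray–Hopf solutions for the fractional Navier–Stokes equations*,
Comm. PDE 44 (2019) 335–365 = arXiv:1801.10235, §5.5 Prop. 5.11 (`‖c_{i,k}‖_N ≲
δ_{q+1}^{1/2}λ_{q+1}⁻¹|k|⁻⁶ℓ^{-N-1}`, "`‖w_c‖₀ + λ_{q+1}⁻¹‖w_c‖₁ ≲ δ_{q+1}^{1/2}ℓ⁻¹λ_{q+1}⁻¹`") and
Prop. 5.12 (the energy estimate, which "does not involve the different structure of the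
Navier–Stokes equations … we refer to [BDLSV2017]" = Buckmaster–De Lellis–Székelyhidi–Vicol,
CPAM 72 (2019), Cor. 5.8 (5.30) and Prop. 6.2, whose proof splits `e(t) - ∫|v_{q+1}|² - δ_{q+2}/2`
into a cross term `2∫w·v̄_q`, a corrector term and a principal term). This file re-runs the tree's
BDSV proofs of these items (`OnsagerBDSVEnergy` — the stage-fact prefix `StageFact`, the facts of
the cross and corrector terms, `toSmoothData`, `stageFact_rhoQ_bounds`; `OnsagerBDSVCorrectorBounds`
— the corrector fact; `OnsagerBDSVEnergyCrossTerm`; `OnsagerBDSVEnergyCorrector`;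
`OnsagerBDSVEnergyCorrectorHolds`; `OnsagerBDSVCorrectorBoundsProofs`) VERBATIM under the weaker
standing hypotheses `DeRosa.CoreHypotheses` of `DeRosaPerturbation.lean`, in the namespace
`DeRosa` (same names as the BDSV twins), continuing `DeRosaPertDeformation.lean` and
`DeRosaPertTransport.lean`:

* `DeRosa.StageFact` (the common quantifier prefix, now over `CoreHypotheses`), `StageFact.and`,
  `StageFact.mono`, `CoreHypotheses.toSmoothData`, `stageFact_rhoQ_bounds`;
* the stage statements `DeRosa.energy_crossTerm`, `DeRosa.energy_correctorTerm` (BDSV Prop. 6.2,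
  cross and corrector terms) and `DeRosa.correctorPartBound` (Cor. 5.8 (5.30) = De Rosa
  Prop. 5.11, the `w_c` display), all PROVED here: `energy_crossTerm_holds`,
  `energy_correctorTerm_holds`, `correctorPartBound_holds` (ports of the BDSV discharges);
* their supporting H-dependent lemmas (`PerturbationData.norm_tildeR_le`,
  `abs_integral_inner_perturbation_vbar_le`, `norm_principalPart_le`, `active_bounds`,
  `principalPart_sup_le`, `correctorPart_sup_le`, `abs_integral_corrector_le`,
  `hasEnvelope_slowPart`, …).

## References

* L. De Rosa, Comm. PDE 44 (2019) 335–365 = arXiv:1801.10235, §5.5 Props. 5.11, 5.12.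
  [`Derosa2018`]
* T. Buckmaster, C. De Lellis, L. Székelyhidi Jr., V. Vicol, CPAM 72 (2019) 229–274 =
  arXiv:1701.08678, Cor. 5.8 (5.30), Prop. 6.2 and its proof (§6.2). [`BuckmasterEtAl2018`]
-/

open MeasureTheory Set
open scoped NNReal ENNReal ContDiff InnerProductSpace Matrix Matrix.Norms.Elementwise
open scoped NNReal ENNReal ContDiff Matrix Matrix.Norms.Elementwise

noncomputable section

namespace Literature.Analysis.FluidPDE

/-! ## Port of `OnsagerBDSVEnergy` -/

namespace DeRosa

open BDSV

open FunctionSpaces FunctionSpaces.Torus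

/-- The flat three-torus `T³ = (ℝ/ℤ)³`, local notation. -/
local notation "𝕋³" => UnitAddTorus (Fin 3)

/-- Euclidean `ℝ³`, local notation. -/
local notation "ℝ³" => EuclideanSpace ℝ (Fin 3)

/-- Real `3 × 3` matrices, local notation. -/
local notation "𝕄" => Matrix (Fin 3) (Fin 3) ℝ

section Split

variable (P : Params) (S : Setting)

end Split

section Prefix

/-- **The quantifier prefix shared by the facts of the perturbation stage** (F₆ `stressEstimate`
and F₇ `energyEstimate` of `OnsagerBDSVPerturbation.lean` — F₅ up to its unused constant, F₄ up to
an extra `∃ M` — and G₁–G₃ below), as a combinator on their bodies `B`: "for every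
Mikado datum `𝔚` and cut-off constant `c₀ > 0` (with derivative constants `C_η`), all
`0 < β < 1/3`, `1 < b < (1-β)/(2β)`, there is `α₀ > 0` such that for `0 < α < α₀` there is a
number of derivatives `N̄` such that for all input constants `C_in, C₀` there are a constant `C`
and a threshold `a₀ > 1` such that for `a ≥ a₀`, every setting `S = (T, e, q, v̄_q, p̄_q, R̊̄_q)`
satisfying the standing hypotheses (`BDSV.CoreHypotheses`) and all construction data
`𝒟` (cut-offs and backward flows), `B(𝔚, (β, α, a, b), C, S, 𝒟)` holds" — the structure
"`α` sufficiently small, `N` suitably chosen, `a` sufficiently large, implicit constants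
depending on everything fixed before" of §§5–6. [cite: BuckmasterEtAl2018, §2.6 and §6 (structure of the constants)] -/
def StageFact (B : MikadoDatum mikadoRadius → (P : Params) → ℝ → (S : Setting) → (c₀ : ℝ) →
    (Cη : ℕ → ℕ → ℝ) → PerturbationData P S c₀ Cη → Prop) : Prop :=
  ∀ (𝔚 : MikadoDatum mikadoRadius) (c₀ : ℝ), 0 < c₀ → ∀ Cη : ℕ → ℕ → ℝ,
    ∀ β : ℝ, 0 < β → β < 1 / 3 → ∀ b : ℝ, 1 < b → b < (1 - β) / (2 * β) →
      ∃ α₀ : ℝ, 0 < α₀ ∧ ∀ α : ℝ, 0 < α → α < α₀ → ∃ Nbar : ℕ, ∀ Cin C₀ : ℝ,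
        ∃ C a₀ : ℝ, 1 < a₀ ∧ ∀ a : ℝ, a₀ ≤ a → ∀ S : Setting,
          CoreHypotheses ⟨β, α, a, b⟩ S Nbar Cin C₀ →
            ∀ 𝒟 : PerturbationData ⟨β, α, a, b⟩ S c₀ Cη, B 𝔚 ⟨β, α, a, b⟩ C S c₀ Cη 𝒟

variable {A B : MikadoDatum mikadoRadius → (P : Params) → ℝ → (S : Setting) → (c₀ : ℝ) →
    (Cη : ℕ → ℕ → ℝ) → PerturbationData P S c₀ Cη → Prop}

/-- **Conjunction of stage facts**: two stage facts whose bodies are monotone in the constant hold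
simultaneously along one prefix (the smaller threshold `α₀`, the larger `N̄`, `C` and `a₀`;
`BDSV.CoreHypotheses.of_le`). [folklore] -/
theorem StageFact.and (hA : StageFact A) (hB : StageFact B)
    (mA : ∀ 𝔚 P C C' S c₀ Cη 𝒟, 1 ≤ P.a → C ≤ C' → A 𝔚 P C S c₀ Cη 𝒟 → A 𝔚 P C' S c₀ Cη 𝒟)
    (mB : ∀ 𝔚 P C C' S c₀ Cη 𝒟, 1 ≤ P.a → C ≤ C' → B 𝔚 P C S c₀ Cη 𝒟 → B 𝔚 P C' S c₀ Cη 𝒟) :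
    StageFact fun 𝔚 P C S c₀ Cη 𝒟 => A 𝔚 P C S c₀ Cη 𝒟 ∧ B 𝔚 P C S c₀ Cη 𝒟 := by
  intro 𝔚 c₀ hc₀ Cη β hβ hβ' b hb hb'
  obtain ⟨αA, hαA, hA⟩ := hA 𝔚 c₀ hc₀ Cη β hβ hβ' b hb hb'
  obtain ⟨αB, hαB, hB⟩ := hB 𝔚 c₀ hc₀ Cη β hβ hβ' b hb hb'
  refine ⟨min αA αB, lt_min hαA hαB, fun α hα hαlt => ?_⟩
  obtain ⟨NA, hA⟩ := hA α hα (lt_of_lt_of_le hαlt (min_le_left _ _))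
  obtain ⟨NB, hB⟩ := hB α hα (lt_of_lt_of_le hαlt (min_le_right _ _))
  refine ⟨max NA NB, fun Cin C₀ => ?_⟩
  obtain ⟨CA, aA, haA, hA⟩ := hA Cin C₀
  obtain ⟨CB, aB, haB, hB⟩ := hB Cin C₀
  refine ⟨max CA CB, max aA aB, lt_max_of_lt_left haA, fun a ha S H 𝒟 => ⟨?_, ?_⟩⟩
  · have ha1 : (1 : ℝ) ≤ a := haA.le.trans ((le_max_left _ _).trans ha)
    exact mA 𝔚 ⟨β, α, a, b⟩ CA (max CA CB) S c₀ Cη 𝒟 ha1 (le_max_left _ _)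
      (hA a ((le_max_left _ _).trans ha) S (H.of_le (le_max_left _ _)) 𝒟)
  · have ha1 : (1 : ℝ) ≤ a := haB.le.trans ((le_max_right _ _).trans ha)
    exact mB 𝔚 ⟨β, α, a, b⟩ CB (max CA CB) S c₀ Cη 𝒟 ha1 (le_max_right _ _)
      (hB a ((le_max_right _ _).trans ha) S (H.of_le (le_max_right _ _)) 𝒟)

/-- **Consequence along the prefix**: if, for all admissible parameters (`c₀ > 0`, `0 < β < 1/3`,
`1 < b`, `0 < α`, `1 < a`) and all data satisfying the standing hypotheses, the body `A` with
constant `C` implies the body `B` with constant `g C`, then the stage fact for `A` gives the one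
for `B`. [folklore] -/
theorem StageFact.mono (g : ℝ → ℝ)
    (h : ∀ 𝔚 P C S c₀ Cη 𝒟, 0 < c₀ → 0 < P.β → P.β < 1 / 3 → 1 < P.b → 0 < P.α → 1 < P.a →
      (∃ (Nbar : ℕ) (Cin C₀ : ℝ), CoreHypotheses P S Nbar Cin C₀) →
        A 𝔚 P C S c₀ Cη 𝒟 → B 𝔚 P (g C) S c₀ Cη 𝒟)
    (hA : StageFact A) : StageFact B := by
  intro 𝔚 c₀ hc₀ Cη β hβ hβ' b hb hb'
  obtain ⟨α₀, hα₀, hA⟩ := hA 𝔚 c₀ hc₀ Cη β hβ hβ' b hb hb'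
  refine ⟨α₀, hα₀, fun α hα hαlt => ?_⟩
  obtain ⟨Nbar, hA⟩ := hA α hα hαlt
  refine ⟨Nbar, fun Cin C₀ => ?_⟩
  obtain ⟨C, a₀, ha₀, hA⟩ := hA Cin C₀
  refine ⟨g C, a₀, ha₀, fun a ha S H 𝒟 => ?_⟩
  exact h 𝔚 ⟨β, α, a, b⟩ C S c₀ Cη 𝒟 hc₀ hβ hβ' hb hα (lt_of_lt_of_le ha₀ ha) ⟨Nbar, Cin, C₀, H⟩
    (hA a ha S H 𝒟)

end Prefix

section Facts

/-- **The cross term of the energy** (BDSV, proof of Prop. 6.2, first estimate: "By integrating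
by parts once and using the identity [(5.28), the BDSV.curl form of `w_{q+1}`] and the estimates [of
Prop. 5.7 on `∇Φ_i` and `b_{i,k}`] we obtain
`|∫_{T³} w_{q+1}·v̄_q dx| = ∑_i ∑_{k≠0} ‖∇Φ_iᵀ (ik × b_k)/|k|²‖₀ ‖v̄_q‖₁ ≲ δ_q^{1/2} δ_{q+1}^{1/2} λ_q / λ_{q+1}`"
— the middle expression standing for `λ_{q+1}⁻¹ ∑ ‖…‖₀ ‖v̄_q‖₁ ≥ λ_{q+1}⁻¹ |∫ Z·BDSV.curl v̄_q|`), along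
the common prefix (`BDSV.StageFact`), for the perturbation `w_{q+1}` of (5.28)
(`BDSV.perturbation`) and every `t ∈ [0,T]`.
[cite: BuckmasterEtAl2018, Prop. 6.2 (proof, estimate of ∫ w_{q+1}·v̄_q)] -/
def energy_crossTerm : Prop :=
  StageFact fun 𝔚 P C S _ _ 𝒟 => ∀ t ∈ Icc 0 S.T,
    |∫ x, ⟪perturbation P S 𝔚 𝒟.cut.η 𝒟.D t x, S.vbar t x⟫_ℝ| ≤
      C * (Real.sqrt (amp P.β P.a P.b S.q) * Real.sqrt (amp P.β P.a P.b (S.q + 1)) *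
        freq P.a P.b S.q * (freq P.a P.b (S.q + 1))⁻¹)

/-- **The corrector terms of the energy** (BDSV, proof of Prop. 6.2, second estimate: "Using
[the estimates of Cor. 5.8 on `w_o` and `w_c`] yields `|∫_{T³} 2w_o·w_c + |w_c|² dx| ≲ δ_{q+1}/(ℓ λ_{q+1})`",
Cor. 5.8 giving `‖w_o‖₀ ≤ (M/4) δ_{q+1}^{1/2}` and `‖w_c‖₀ ≲ δ_{q+1}^{1/2} ℓ⁻¹ λ_{q+1}⁻¹`, and
(6.6) `ℓ λ_{q+1} ≥ 1`), along the common prefix, for the split `w_{q+1} = w_o + w_c`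
(`BDSV.principalPart`, `BDSV.correctorPart`) and every `t ∈ [0,T]`; `ℓ = BDSV.mollScale`.
[cite: BuckmasterEtAl2018, Prop. 6.2 (proof, estimate of ∫ 2w_o·w_c + |w_c|²)] -/
def energy_correctorTerm : Prop :=
  StageFact fun 𝔚 P C S _ _ 𝒟 => ∀ t ∈ Icc 0 S.T,
    |∫ x, (2 * ⟪principalPart P S 𝔚 𝒟.cut.η 𝒟.D t x, correctorPart P S 𝔚 𝒟.cut.η 𝒟.D t x⟫_ℝ +
        ‖correctorPart P S 𝔚 𝒟.cut.η 𝒟.D t x‖ ^ 2)| ≤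
      C * (amp P.β P.a P.b (S.q + 1) * (mollScale P.β P.α P.a P.b S.q)⁻¹ *
        (freq P.a P.b (S.q + 1))⁻¹)

end Facts

section Smooth

variable {S' : Set ℝ}

variable {P : Params} {S : Setting} {η : ℕ → ℝ → 𝕋³ → ℝ} {D : ℕ → ℝ → 𝕋³ → ℝ³}

namespace SmoothData

variable (h : SmoothData P S η D)

end SmoothData

/-- Under the standing hypotheses, with `ρ_q > 0` on `[0,T]` and `c₀ > 0`, the construction data
are smooth data (`BDSV.SmoothData`): `∑_j ∫ η_j² ≥ c₀ > 0` by property (v) of the cut-offs. [folklore] -/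
theorem CoreHypotheses.toSmoothData {Nbar : ℕ} {Cin C₀ c₀ : ℝ} {Cη : ℕ → ℕ → ℝ}
    (H : CoreHypotheses P S Nbar Cin C₀) (hc₀ : 0 < c₀) (𝒟 : PerturbationData P S c₀ Cη)
    (hρ : ∀ t ∈ Icc 0 S.T, 0 < rhoQ P S t) : SmoothData P S 𝒟.cut.η 𝒟.D where
  pos_T := H.pos_T
  e := H.profile.smooth
  vbar := H.eulerReynolds.smooth_velocity
  pbar := H.eulerReynolds.smooth_pressure
  Rbar := H.eulerReynolds.smooth_stress
  eta := 𝒟.cut.smooth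
  disp i := (𝒟.flow i).smooth
  rho_pos := hρ
  mass_pos t ht := lt_of_lt_of_le hc₀ (𝒟.cut.sum_sq_ge t ht)

end Smooth

section Assembly

/-- **G₀ along the common prefix** (BDSV Lemma 5.4: "`δ_{q+1}/(8λ_q^α) ≤ |ρ_q(t)| ≤ δ_{q+1}` for
all `t`", in the form without absolute value that its proof gives and that is used): under the
standing hypotheses (which contain the energy gap (5.2)), for `α < α₀ = βb(b-1)` and `a` beyond
the threshold of `BDSV.exists_threshold_four_amp` (`4δ_{q+2} ≤ δ_{q+1}λ_q^{-α}`), the bounds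
`BDSV.CoreHypotheses.le_rhoQ` / `.rhoQ_le` of `OnsagerBDSVPerturbationFlowBounds.lean`
hold along the prefix (with `N̄ = 0`, no constant). [cite: BuckmasterEtAl2018, Lemma 5.4 (bounds on ρ_q)] -/
theorem stageFact_rhoQ_bounds :
    StageFact fun _ P _ S _ _ _ => ∀ t ∈ Icc 0 S.T,
      amp P.β P.a P.b (S.q + 1) * freq P.a P.b S.q ^ (-P.α) / 8 ≤ rhoQ P S t ∧
        rhoQ P S t ≤ amp P.β P.a P.b (S.q + 1) := by
  intro 𝔚 c₀ hc₀ Cη β hβ hβ' b hb hb'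
  have hb0 : (0 : ℝ) < b := by linarith
  refine ⟨β * b * (b - 1), by nlinarith [mul_pos hβ hb0], fun α hα hαlt => ⟨0, fun Cin C₀ => ?_⟩⟩
  have hαb : α < 2 * β * b * (b - 1) := by nlinarith [mul_pos hβ hb0]
  obtain ⟨a₁, ha₁, h4⟩ := exists_threshold_four_amp hb hαb
  exact ⟨0, a₁, ha₁, fun a ha S H 𝒟 t ht =>
    ⟨H.le_rhoQ (h4 a ha S.q) ht, H.rhoQ_le (ha₁.le.trans ha) ht⟩⟩

variable {β α a b : ℝ}

end Assembly

end DeRosa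

/-! ## Port of `OnsagerBDSVCorrectorBounds` -/

namespace DeRosa

open BDSV

open FunctionSpaces FunctionSpaces.Torus

/-- **Cor. 5.8, the corrector** (arXiv (5.30): "`‖w_c‖₀ + λ_{q+1}⁻¹‖w_c‖₁ ≲ δ_{q+1}^{1/2}ℓ⁻¹λ_{q+1}^{N-1}`"
[sic; the proof and all uses have `λ_{q+1}^{-1}`, module docstring]; proof: "a direct consequence
of (5.26) and (5.33)"). Transcription (module docstring): along `BDSV.StageFact`, for
`w_c = BDSV.correctorPart`, `‖w_c‖₀ ≤ C δ_{q+1}^{1/2} ℓ⁻¹ λ_{q+1}⁻¹` and `[w_c]₁ ≤ C δ_{q+1}^{1/2} ℓ⁻¹`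
on `[0,T] × T³`, `ℓ = BDSV.mollScale`. [cite: BuckmasterEtAl2018, Cor. 5.8 (arXiv (5.30))] -/
def correctorPartBound : Prop :=
  StageFact fun 𝔚 P C S _ _ 𝒟 =>
    SupLE S.T (correctorPart P S 𝔚 𝒟.cut.η 𝒟.D)
        (C * (Real.sqrt (amp P.β P.a P.b (S.q + 1)) * (mollScale P.β P.α P.a P.b S.q)⁻¹ *
          (freq P.a P.b (S.q + 1))⁻¹)) ∧
      DerivSupLE S.T (correctorPart P S 𝔚 𝒟.cut.η 𝒟.D)
        (C * (Real.sqrt (amp P.β P.a P.b (S.q + 1)) * (mollScale P.β P.α P.a P.b S.q)⁻¹))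

end DeRosa

/-! ## Port of `OnsagerBDSVEnergyCrossTerm` -/

namespace DeRosa

open BDSV

open FunctionSpaces FunctionSpaces.Torus

section Mono

variable {P : Params} {S : Setting} {Nbar : ℕ} {Cin Cin' C₀ : ℝ}

end Mono

section Pointwise

variable {P : Params} {S : Setting} {Nbar : ℕ} {Cin C₀ c₀ : ℝ} {Cη : ℕ → ℕ → ℝ}

/-- `λ_q^α ℓ^α ≤ 1` for `a, b ≥ 1`, `β, α ≥ 0` (`ℓ ≤ λ_q^{-1-3α/2}`; the exponent-`3α` version is
`BDSV.freq_rpow_mul_mollScale_rpow_le_one` of `OnsagerBDSVGluedParams.lean`). [folklore] -/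
private theorem freq_rpow_mul_mollScale_rpow_le_one₁ {β α a b : ℝ} (ha : 1 ≤ a) (hb : 1 ≤ b) (hβ : 0 ≤ β)
    (hα : 0 ≤ α) (q : ℕ) : freq a b q ^ α * mollScale β α a b q ^ α ≤ 1 := by
  have hf := freq_pos (b := b) ha q
  have h1f : 1 ≤ freq a b q := le_trans (by linarith [Real.two_le_pi]) (two_pi_le_freq ha q)
  have h1 := mollScale_rpow_le_mul ha hb hβ hα q
  have h2 : freq a b q ^ (-(3 * α ^ 2 / 2)) ≤ 1 :=
    Real.rpow_le_one_of_one_le_of_nonpos h1f (by nlinarith [sq_nonneg α])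
  calc freq a b q ^ α * mollScale β α a b q ^ α
      ≤ freq a b q ^ α * (freq a b q ^ (-α) * freq a b q ^ (-(3 * α ^ 2 / 2))) :=
        mul_le_mul_of_nonneg_left h1 (Real.rpow_nonneg hf.le _)
    _ = freq a b q ^ (-(3 * α ^ 2 / 2)) := by
        rw [← mul_assoc, ← Real.rpow_add hf, add_neg_cancel, Real.rpow_zero, one_mul]
    _ ≤ 1 := h2

/-- **`‖∇Φ_i‖_∞ ≤ e^{4C_in}` on the support of `η_i`** (from Lemma 5.4 via App. B:
`|∂ⱼ(Φ_i - id)_a| ≤ e^{4 C_in ℓ^{2α}} - 1` there, and `ℓ^{2α} ≤ 1`). [cite: BuckmasterEtAl2018, Lemma 5.4] -/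
theorem PerturbationData.norm_gradPhi_le (H : CoreHypotheses P S Nbar Cin C₀)
    (𝒟 : PerturbationData P S c₀ Cη) (hCin : 0 ≤ Cin) (ha : 1 ≤ P.a) (hb : 1 ≤ P.b) (hβ : 0 ≤ P.β)
    (hα : 0 ≤ P.α) {i : ℕ} {t : ℝ} (ht : t ∈ Icc 0 S.T) {x' : UnitAddTorus (Fin 3)}
    (hη : 𝒟.cut.η i t x' ≠ 0) (x : UnitAddTorus (Fin 3)) :
    ‖gradPhi 𝒟.D i t x‖ ≤ Real.exp (4 * Cin) := by
  have hpos : 0 ≤ Real.exp (4 * Cin) := (Real.exp_pos _).le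
  rw [Matrix.norm_le_iff hpos]
  intro a j
  have hD := 𝒟.abs_partialDeriv_D_le_of_eta_ne_zero H hCin ha ht hη x a j
  have hℓ : mollScale P.β P.α P.a P.b S.q ^ (2 * P.α) ≤ 1 :=
    mollScale_rpow_two_mul_le_one ha hb hβ hα S.q
  have hexp : Real.exp (4 * (Cin * mollScale P.β P.α P.a P.b S.q ^ (2 * P.α))) ≤
      Real.exp (4 * Cin) :=
    Real.exp_le_exp.2 (by nlinarith [mul_le_mul_of_nonneg_left hℓ hCin])
  have h1 : |(1 : Matrix (Fin 3) (Fin 3) ℝ) a j| ≤ 1 := by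
    rw [Matrix.one_apply]; split_ifs <;> simp
  rw [Real.norm_eq_abs, gradPhi, Matrix.add_apply, Matrix.of_apply]
  calc |(1 : Matrix (Fin 3) (Fin 3) ℝ) a j + Torus.partialDeriv j (𝒟.D i t) x a|
      ≤ |(1 : Matrix (Fin 3) (Fin 3) ℝ) a j| + |Torus.partialDeriv j (𝒟.D i t) x a| := abs_add_le _ _
    _ ≤ 1 + (Real.exp (4 * (Cin * mollScale P.β P.α P.a P.b S.q ^ (2 * P.α))) - 1) :=
        add_le_add h1 hD
    _ ≤ Real.exp (4 * Cin) := by linarith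

/-- The sup bound `‖R̊̄_q(t,x)‖ ≤ C_in δ_{q+1} ℓ^α` read off (2.20)|_{N=0} (for `C_in ≥ 0`, `a ≥ 1`),
and with it the entry bound `‖ofCols R̊̄_q(t,x)‖_∞ ≤ C_in δ_{q+1} ℓ^α`. [cite: BuckmasterEtAl2018, §2.5 (2.20)] -/
theorem CoreHypotheses.norm_ofCols_Rbar_le (H : CoreHypotheses P S Nbar Cin C₀)
    (hCin : 0 ≤ Cin) (ha : 1 ≤ P.a) {t : ℝ} (ht : t ∈ Icc 0 S.T) (x : UnitAddTorus (Fin 3)) :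
    ‖ofCols (S.Rbar t x)‖ ≤
      Cin * (amp P.β P.a P.b (S.q + 1) * mollScale P.β P.α P.a P.b S.q ^ P.α) := by
  have hs := H.stress 0 (Nat.zero_le _) t ht
  simp only [Nat.cast_zero, neg_zero, zero_add] at hs
  have hB : 0 ≤ Cin * (amp P.β P.a P.b (S.q + 1) * mollScale P.β P.α P.a P.b S.q ^ P.α) :=
    mul_nonneg hCin (mul_nonneg (amp_pos ha _).le (Real.rpow_nonneg (mollScale_pos ha _).le _))
  have hR : ‖S.Rbar t x‖ ≤
      Cin * (amp P.β P.a P.b (S.q + 1) * mollScale P.β P.α P.a P.b S.q ^ P.α) :=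
    norm_le_of_eContDiffHolderNorm_zero_le hB hs x
  rw [Matrix.norm_le_iff hB]
  intro i j
  rw [ofCols_apply]
  calc ‖S.Rbar t x j i‖ ≤ ‖S.Rbar t x j‖ := by
        rw [Real.norm_eq_abs, ← Real.norm_eq_abs]
        exact PiLp.norm_apply_le (S.Rbar t x j) i |>.trans_eq' (by simp)
    _ ≤ ‖S.Rbar t x‖ := norm_le_pi_norm _ j
    _ ≤ _ := hR

/-- **Confinement of `R̃_{q,i}` on the support of `η_i`** (crude form): for `C_in ≥ 0`, `a ≥ 1`
and `4δ_{q+2} ≤ δ_{q+1}λ_q^{-α}` (so that `ρ_q ≥ δ_{q+1}λ_q^{-α}/8 > 0`),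
`‖R̃_{q,i}(t,x)‖_∞ ≤ 9 e^{8C_in}(1 + 8C_in)` wherever `η_i(t,·) ≠ 0` somewhere: by (5.32)
`R̃ = ∇Φ (Id - (∑∫η²/ρ_q) R̊̄) ∇Φᵀ` with `‖∇Φ‖_∞ ≤ e^{4C_in}`, `∑∫η² ≤ 1`,
`‖R̊̄‖ ≤ C_in δ_{q+1} ℓ^α` and `λ_q^α ℓ^α ≤ 1`. [cite: BuckmasterEtAl2018, Lemma 5.4 (proof)] -/
theorem PerturbationData.norm_tildeR_le (H : CoreHypotheses P S Nbar Cin C₀)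
    (𝒟 : PerturbationData P S c₀ Cη) (hCin : 0 ≤ Cin) (ha : 1 ≤ P.a) (hb : 1 ≤ P.b) (hβ : 0 ≤ P.β)
    (hα : 0 ≤ P.α)
    (h4 : 4 * amp P.β P.a P.b (S.q + 2) ≤ amp P.β P.a P.b (S.q + 1) * freq P.a P.b S.q ^ (-P.α))
    {i : ℕ} {t : ℝ} (ht : t ∈ Icc 0 S.T) {x' : UnitAddTorus (Fin 3)} (hη : 𝒟.cut.η i t x' ≠ 0)
    (x : UnitAddTorus (Fin 3)) :
    ‖tildeR P S 𝒟.cut.η 𝒟.D i t x‖ ≤ 9 * Real.exp (8 * Cin) * (1 + 8 * Cin) := by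
  set G := gradPhi 𝒟.D i t x with hG
  set M : Matrix (Fin 3) (Fin 3) ℝ :=
    1 - (etaMass P S 𝒟.cut.η t / rhoQ P S t) • ofCols (S.Rbar t x) with hM
  have hGle : ‖G‖ ≤ Real.exp (4 * Cin) := 𝒟.norm_gradPhi_le H hCin ha hb hβ hα ht hη x
  have hGt : ‖Gᵀ‖ ≤ Real.exp (4 * Cin) := by rw [Matrix.norm_transpose]; exact hGle
  -- the scalar `c = ∑∫η² / ρ_q`
  have hδ : 0 < amp P.β P.a P.b (S.q + 1) := amp_pos ha _
  have hfa : 0 < freq P.a P.b S.q ^ (-P.α) := Real.rpow_pos_of_pos (freq_pos ha _) _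
  have hρlow := H.le_rhoQ h4 ht
  have hρpos : 0 < rhoQ P S t := lt_of_lt_of_le (by positivity) hρlow
  have hm0 : 0 ≤ etaMass P S 𝒟.cut.η t := by
    unfold etaMass
    exact Finset.sum_nonneg fun j _ => integral_nonneg fun y => sq_nonneg _
  have hm1 : etaMass P S 𝒟.cut.η t ≤ 1 := 𝒟.etaMass_le_one ht
  have hc0 : 0 ≤ etaMass P S 𝒟.cut.η t / rhoQ P S t := div_nonneg hm0 hρpos.le
  have hc : etaMass P S 𝒟.cut.η t / rhoQ P S t ≤
      8 * freq P.a P.b S.q ^ P.α / amp P.β P.a P.b (S.q + 1) := by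
    rw [div_le_div_iff₀ hρpos hδ]
    have hinv : freq P.a P.b S.q ^ P.α * freq P.a P.b S.q ^ (-P.α) = 1 := by
      rw [← Real.rpow_add (freq_pos ha _), add_neg_cancel, Real.rpow_zero]
    calc etaMass P S 𝒟.cut.η t * amp P.β P.a P.b (S.q + 1)
        ≤ 1 * amp P.β P.a P.b (S.q + 1) := mul_le_mul_of_nonneg_right hm1 hδ.le
      _ = 8 * freq P.a P.b S.q ^ P.α *
          (amp P.β P.a P.b (S.q + 1) * freq P.a P.b S.q ^ (-P.α) / 8) := by
          rw [one_mul]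
          calc amp P.β P.a P.b (S.q + 1)
              = amp P.β P.a P.b (S.q + 1) *
                  (freq P.a P.b S.q ^ P.α * freq P.a P.b S.q ^ (-P.α)) := by
                rw [hinv, mul_one]
            _ = _ := by ring
      _ ≤ 8 * freq P.a P.b S.q ^ P.α * rhoQ P S t :=
          mul_le_mul_of_nonneg_left hρlow
            (mul_nonneg (by norm_num) (Real.rpow_nonneg (freq_pos ha _).le _))
  -- `‖c • ofCols R̊̄‖ ≤ 8 C_in`
  have hR := H.norm_ofCols_Rbar_le hCin ha ht x
  have hcR : ‖(etaMass P S 𝒟.cut.η t / rhoQ P S t) • ofCols (S.Rbar t x)‖ ≤ 8 * Cin := by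
    rw [norm_smul, Real.norm_eq_abs, abs_of_nonneg hc0]
    have hprod := freq_rpow_mul_mollScale_rpow_le_one₁ ha hb hβ hα S.q (β := P.β)
    calc etaMass P S 𝒟.cut.η t / rhoQ P S t * ‖ofCols (S.Rbar t x)‖
        ≤ (8 * freq P.a P.b S.q ^ P.α / amp P.β P.a P.b (S.q + 1)) *
            (Cin * (amp P.β P.a P.b (S.q + 1) * mollScale P.β P.α P.a P.b S.q ^ P.α)) :=
          mul_le_mul hc hR (norm_nonneg _)
            (div_nonneg (mul_nonneg (by norm_num) (Real.rpow_nonneg (freq_pos ha _).le _)) hδ.le)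
      _ = 8 * Cin * (freq P.a P.b S.q ^ P.α * mollScale P.β P.α P.a P.b S.q ^ P.α) := by
          field_simp
      _ ≤ 8 * Cin * 1 := mul_le_mul_of_nonneg_left hprod (by positivity)
      _ = 8 * Cin := mul_one _
  have hMle : ‖M‖ ≤ 1 + 8 * Cin :=
    (norm_sub_le _ _).trans (add_le_add norm_one_matrix_le hcR)
  -- assemble `‖G M Gᵀ‖ ≤ 3 ‖G M‖ ‖Gᵀ‖ ≤ 9 ‖G‖ ‖M‖ ‖Gᵀ‖`
  have hexp0 : 0 ≤ Real.exp (4 * Cin) := (Real.exp_pos _).le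
  have hM0 : 0 ≤ 1 + 8 * Cin := by linarith
  have h1 : ‖G * M‖ ≤ 3 * Real.exp (4 * Cin) * (1 + 8 * Cin) :=
    (norm_matrix_mul_le G M).trans (by gcongr)
  have h2 : ‖G * M * Gᵀ‖ ≤ 3 * (3 * Real.exp (4 * Cin) * (1 + 8 * Cin)) * Real.exp (4 * Cin) :=
    (norm_matrix_mul_le (G * M) Gᵀ).trans (by gcongr)
  have hexp : Real.exp (4 * Cin) * Real.exp (4 * Cin) = Real.exp (8 * Cin) := by
    rw [← Real.exp_add]; ring_nf
  calc ‖tildeR P S 𝒟.cut.η 𝒟.D i t x‖ = ‖G * M * Gᵀ‖ := by rw [tildeR]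
    _ ≤ 3 * (3 * Real.exp (4 * Cin) * (1 + 8 * Cin)) * Real.exp (4 * Cin) := h2
    _ = 9 * Real.exp (8 * Cin) * (1 + 8 * Cin) := by rw [← hexp]; ring

/-- **`|ρ_{q,i}^{1/2}| ≤ (δ_{q+1}/c₀)^{1/2}`** on `[0,T] × T³` (Lemma 5.4: `ρ_q ≤ δ_{q+1}`,
`∑_j∫η_j² ≥ c₀ > 0`, `0 ≤ η_i ≤ 1`). [cite: BuckmasterEtAl2018, Lemma 5.4] -/
theorem PerturbationData.abs_sqrtRhoI_le (H : CoreHypotheses P S Nbar Cin C₀)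
    (𝒟 : PerturbationData P S c₀ Cη) (hc₀ : 0 < c₀) (ha : 1 ≤ P.a) {t : ℝ} (ht : t ∈ Icc 0 S.T)
    (i : ℕ) (x : UnitAddTorus (Fin 3)) :
    |sqrtRhoI P S 𝒟.cut.η i t x| ≤ Real.sqrt (amp P.β P.a P.b (S.q + 1) / c₀) := by
  have hm : c₀ ≤ etaMass P S 𝒟.cut.η t := 𝒟.le_etaMass ht
  have hm0 : 0 < etaMass P S 𝒟.cut.η t := hc₀.trans_le hm
  have hq : rhoQ P S t / etaMass P S 𝒟.cut.η t ≤ amp P.β P.a P.b (S.q + 1) / c₀ :=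
    calc rhoQ P S t / etaMass P S 𝒟.cut.η t
        ≤ amp P.β P.a P.b (S.q + 1) / etaMass P S 𝒟.cut.η t :=
          div_le_div_of_nonneg_right (H.rhoQ_le ha ht) hm0.le
      _ ≤ amp P.β P.a P.b (S.q + 1) / c₀ :=
          div_le_div_of_nonneg_left (amp_pos ha _).le hc₀ hm
  have hη0 := 𝒟.cut.nonneg i t x
  have hη1 := 𝒟.cut.le_one i t x
  rw [sqrtRhoI, abs_mul, abs_of_nonneg hη0, abs_of_nonneg (Real.sqrt_nonneg _)]
  calc 𝒟.cut.η i t x * Real.sqrt (rhoQ P S t / etaMass P S 𝒟.cut.η t)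
      ≤ 1 * Real.sqrt (amp P.β P.a P.b (S.q + 1) / c₀) :=
        mul_le_mul hη1 (Real.sqrt_le_sqrt hq) (Real.sqrt_nonneg _) zero_le_one
    _ = _ := one_mul _

end Pointwise

section Discharge

variable {P : Params} {S : Setting} {Nbar : ℕ} {Cin C₀ c₀ : ℝ} {Cη : ℕ → ℕ → ℝ}

/-- **The cross-term bound at fixed parameters** (the heart of the first estimate of the proof of
Prop. 6.2): under the standing hypotheses with `C_in ≥ 0`, `c₀ > 0`, `a ≥ 1` and
`4δ_{q+2} ≤ δ_{q+1}λ_q^{-α}`, if the Mikado potential is bounded by `K_V` on the ball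
`‖R‖_∞ ≤ 9e^{8C_in}(1 + 8C_in)`, then
`|∫ ⟪w_{q+1}, v̄_q⟫| ≤ (2π · 54 · e^{4C_in} K_V C_in / c₀^{1/2}) · δ_q^{1/2} δ_{q+1}^{1/2} λ_q λ_{q+1}⁻¹`
on `[0,T]`. [cite: BuckmasterEtAl2018, Prop. 6.2 (proof, estimate of ∫ w_{q+1}·v̄_q)] -/
theorem PerturbationData.abs_integral_inner_perturbation_vbar_le
    (H : CoreHypotheses P S Nbar Cin C₀) (𝒟 : PerturbationData P S c₀ Cη)
    (𝔚 : MikadoDatum mikadoRadius) (hc₀ : 0 < c₀) (hCin : 0 ≤ Cin) (ha : 1 ≤ P.a) (hb : 1 ≤ P.b)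
    (hβ : 0 ≤ P.β) (hα : 0 ≤ P.α)
    (h4 : 4 * amp P.β P.a P.b (S.q + 2) ≤ amp P.β P.a P.b (S.q + 1) * freq P.a P.b S.q ^ (-P.α))
    {KV : ℝ} (hKV0 : 0 ≤ KV)
    (hKV : ∀ R ∈ Metric.closedBall (0 : Matrix (Fin 3) (Fin 3) ℝ)
      (9 * Real.exp (8 * Cin) * (1 + 8 * Cin)), ∀ ξ : UnitAddTorus (Fin 3), ‖𝔚.V R ξ‖ ≤ KV)
    {t : ℝ} (ht : t ∈ Icc 0 S.T) :
    |∫ x, ⟪perturbation P S 𝔚 𝒟.cut.η 𝒟.D t x, S.vbar t x⟫_ℝ| ≤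
      (2 * Real.pi * 54 * Real.exp (4 * Cin) * KV * Cin / Real.sqrt c₀) *
        (Real.sqrt (amp P.β P.a P.b S.q) * Real.sqrt (amp P.β P.a P.b (S.q + 1)) *
          freq P.a P.b S.q * (freq P.a P.b (S.q + 1))⁻¹) := by
  -- positivity of `ρ_q`, smoothness
  have hρpos : ∀ s ∈ Icc 0 S.T, 0 < rhoQ P S s := fun s hs =>
    lt_of_lt_of_le (div_pos (mul_pos (amp_pos ha _) (Real.rpow_pos_of_pos (freq_pos ha _) _))
      (by norm_num)) (H.le_rhoQ h4 hs)
  have hSD : SmoothData P S 𝒟.cut.η 𝒟.D := H.toSmoothData hc₀ 𝒟 hρpos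
  have hZ : IsSmooth (potential P S 𝔚 𝒟.cut.η 𝒟.D t) := (hSD.potential 𝔚).isSmooth_slice ht
  have hv : IsSmooth (S.vbar t) := H.eulerReynolds.smooth_velocity.isSmooth_slice ht
  -- Step 1: `∫ ⟪w, v̄⟫ = n⁻¹ ∫ ⟪Z, BDSV.curl v̄⟫`
  set n : ℕ := P.freqNat (S.q + 1) with hn
  have hw : (fun x => ⟪perturbation P S 𝔚 𝒟.cut.η 𝒟.D t x, S.vbar t x⟫_ℝ) =
      fun x => ((n : ℝ))⁻¹ * ⟪BDSV.curl (potential P S 𝔚 𝒟.cut.η 𝒟.D t) x, S.vbar t x⟫_ℝ := by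
    funext x
    rw [perturbation, real_inner_smul_left]
  have hI : ∫ x, ⟪perturbation P S 𝔚 𝒟.cut.η 𝒟.D t x, S.vbar t x⟫_ℝ =
      ((n : ℝ))⁻¹ * ∫ x, ⟪potential P S 𝔚 𝒟.cut.η 𝒟.D t x, BDSV.curl (S.vbar t) x⟫_ℝ := by
    rw [hw, integral_const_mul, integral_inner_curl_comm hZ hv]
  -- Step 2: `‖BDSV.curl v̄‖ ≤ 6 C_in δ_q^{1/2} λ_q`
  have hcurl : ∀ x, ‖BDSV.curl (S.vbar t) x‖ ≤
      6 * (Cin * (Real.sqrt (amp P.β P.a P.b S.q) * freq P.a P.b S.q)) := by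
    intro x
    refine BDSV.norm_curl_le fun j => ?_
    have hvj := H.velocity 0 (Nat.zero_le _) t ht
    simp only [Nat.cast_zero, neg_zero, Real.rpow_zero, mul_one, zero_add] at hvj
    exact norm_partialDeriv_le_of_eContDiffHolderNorm_le (hv.isContDiff (by simp))
      (mul_nonneg hCin (mul_nonneg (Real.sqrt_nonneg _) (freq_pos ha _).le)) hvj j x
  -- Step 3: `‖Z‖ ≤ (δ_{q+1}/c₀)^{1/2} · 9 e^{4C_in} · K_V`
  set KZ : ℝ := Real.sqrt (amp P.β P.a P.b (S.q + 1) / c₀) * (9 * Real.exp (4 * Cin) * KV)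
    with hKZ
  have hKZ0 : 0 ≤ KZ := by positivity
  have hZle : ∀ x, ‖potential P S 𝔚 𝒟.cut.η 𝒟.D t x‖ ≤ KZ := by
    intro x
    refine 𝒟.cut.norm_sum_le t x hKZ0
      (fun i hi => by rw [sqrtRhoI, hi, zero_mul, zero_smul]) ?_ _
    intro i
    by_cases hη : 𝒟.cut.η i t x = 0
    · rw [sqrtRhoI, hη, zero_mul, zero_smul, norm_zero]
      exact hKZ0
    · rw [norm_smul, Real.norm_eq_abs]
      have h1 := 𝒟.abs_sqrtRhoI_le H hc₀ ha ht i x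
      have hG : ‖(gradPhi 𝒟.D i t x)ᵀ‖ ≤ Real.exp (4 * Cin) := by
        rw [Matrix.norm_transpose]
        exact 𝒟.norm_gradPhi_le H hCin ha hb hβ hα ht hη x
      have hRt : tildeR P S 𝒟.cut.η 𝒟.D i t x ∈
          Metric.closedBall (0 : Matrix (Fin 3) (Fin 3) ℝ)
            (9 * Real.exp (8 * Cin) * (1 + 8 * Cin)) := by
        rw [Metric.mem_closedBall, dist_zero_right]
        exact 𝒟.norm_tildeR_le H hCin ha hb hβ hα h4 ht hη x
      have hVle := hKV _ hRt (n • phiPoint 𝒟.D i t x)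
      have h2 := norm_toEuclideanLin_le (gradPhi 𝒟.D i t x)ᵀ
        (𝔚.V (tildeR P S 𝒟.cut.η 𝒟.D i t x) (n • phiPoint 𝒟.D i t x))
      have h3 : 9 * ‖(gradPhi 𝒟.D i t x)ᵀ‖ *
          ‖𝔚.V (tildeR P S 𝒟.cut.η 𝒟.D i t x) (n • phiPoint 𝒟.D i t x)‖ ≤
          9 * Real.exp (4 * Cin) * KV :=
        mul_le_mul (mul_le_mul_of_nonneg_left hG (by norm_num)) hVle (norm_nonneg _)
          (by positivity)
      calc |sqrtRhoI P S 𝒟.cut.η i t x| *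
            ‖Matrix.toEuclideanLin (gradPhi 𝒟.D i t x)ᵀ
              (𝔚.V (tildeR P S 𝒟.cut.η 𝒟.D i t x) (n • phiPoint 𝒟.D i t x))‖
          ≤ Real.sqrt (amp P.β P.a P.b (S.q + 1) / c₀) * (9 * Real.exp (4 * Cin) * KV) :=
            mul_le_mul h1 (h2.trans h3) (norm_nonneg _) (Real.sqrt_nonneg _)
        _ = KZ := rfl
  -- Step 4: put together
  have hfreq : freq P.a P.b (S.q + 1) = 2 * Real.pi * (n : ℝ) := by
    rw [hn]
    exact P.freq_eq (by linarith) (S.q + 1)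
  have hn0 : (0 : ℝ) < n := by
    have hf := freq_pos (b := P.b) ha (S.q + 1)
    rw [hfreq] at hf
    exact pos_of_mul_pos_right hf (by positivity)
  have hninv : ((n : ℝ))⁻¹ = 2 * Real.pi * (freq P.a P.b (S.q + 1))⁻¹ := by
    rw [hfreq]
    field_simp
  have hint := abs_integral_inner_le hZle hcurl hKZ0
  rw [hI, abs_mul, abs_of_pos (inv_pos.2 hn0), hninv]
  have hsq : Real.sqrt (amp P.β P.a P.b (S.q + 1) / c₀) =
      Real.sqrt (amp P.β P.a P.b (S.q + 1)) / Real.sqrt c₀ :=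
    Real.sqrt_div (amp_pos ha _).le c₀
  have hf1 : 0 ≤ (freq P.a P.b (S.q + 1))⁻¹ := inv_nonneg.2 (freq_pos ha _).le
  have hc0' : Real.sqrt c₀ ≠ 0 := (Real.sqrt_pos.2 hc₀).ne'
  calc 2 * Real.pi * (freq P.a P.b (S.q + 1))⁻¹ *
        |∫ x, ⟪potential P S 𝔚 𝒟.cut.η 𝒟.D t x, BDSV.curl (S.vbar t) x⟫_ℝ|
      ≤ 2 * Real.pi * (freq P.a P.b (S.q + 1))⁻¹ *
          (KZ * (6 * (Cin * (Real.sqrt (amp P.β P.a P.b S.q) * freq P.a P.b S.q)))) :=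
        mul_le_mul_of_nonneg_left hint (by positivity)
    _ = (2 * Real.pi * 54 * Real.exp (4 * Cin) * KV * Cin / Real.sqrt c₀) *
        (Real.sqrt (amp P.β P.a P.b S.q) * Real.sqrt (amp P.β P.a P.b (S.q + 1)) *
          freq P.a P.b S.q * (freq P.a P.b (S.q + 1))⁻¹) := by
        rw [hKZ, hsq]
        field_simp
        ring

/-- **Discharge of G₁ `BDSV.energy_crossTerm`** (BDSV, proof of Prop. 6.2, first estimate):
along the common prefix, `|∫_{T³} ⟪w_{q+1}, v̄_q⟫ dx| ≤ C δ_q^{1/2} δ_{q+1}^{1/2} λ_q λ_{q+1}⁻¹` for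
every `t ∈ [0,T]`, with `α₀ = βb(b-1)`, `N̄ = 0`,
`C = 2π · 54 · e^{4C⁺} K_V C⁺ / c₀^{1/2}` (`C⁺ = max(C_in, 0)`, `K_V` the bound of the Mikado
potential on the ball `‖R‖_∞ ≤ 9e^{8C⁺}(1 + 8C⁺)`) and `a₀` the threshold of
`4δ_{q+2} ≤ δ_{q+1}λ_q^{-α}` (`BDSV.exists_threshold_four_amp`).
[cite: BuckmasterEtAl2018, Prop. 6.2 (proof, estimate of ∫ w_{q+1}·v̄_q)] -/
theorem energy_crossTerm_holds : energy_crossTerm := by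
  intro 𝔚 c₀ hc₀ Cη β hβ hβ' b hb hb'
  have hb0 : (0 : ℝ) < b := by linarith
  refine ⟨β * b * (b - 1), by nlinarith [mul_pos hβ hb0], fun α hα hαlt => ⟨0, fun Cin C₀ => ?_⟩⟩
  have hαb : α < 2 * β * b * (b - 1) := by nlinarith [mul_pos hβ hb0]
  obtain ⟨a₁, ha₁, hpar⟩ := exists_threshold_four_amp hb hαb
  have hCp0 : 0 ≤ max Cin 0 := le_max_right _ _
  obtain ⟨KV, hKV0, hKV⟩ := 𝔚.exists_bound_V
    (isCompact_closedBall (0 : Matrix (Fin 3) (Fin 3) ℝ)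
      (9 * Real.exp (8 * max Cin 0) * (1 + 8 * max Cin 0)))
  refine ⟨2 * Real.pi * 54 * Real.exp (4 * max Cin 0) * KV * max Cin 0 / Real.sqrt c₀, a₁, ha₁,
    fun a ha S H 𝒟 t ht => ?_⟩
  have ha1 : (1 : ℝ) ≤ a := ha₁.le.trans ha
  exact 𝒟.abs_integral_inner_perturbation_vbar_le (H.mono_const ha1 (le_max_left _ _)) 𝔚 hc₀
    hCp0 ha1 hb.le hβ.le hα.le (hpar a ha S.q) hKV0 hKV ht

end Discharge

end DeRosa

/-! ## Port of `OnsagerBDSVEnergyCorrector` -/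

namespace DeRosa

open BDSV

open FunctionSpaces FunctionSpaces.Torus

section Principal

variable {P : Params} {S : Setting} {Nbar : ℕ} {Cin C₀ c₀ : ℝ} {Cη : ℕ → ℕ → ℝ}

/-- **Sup bound on the principal part** (the qualitative content of (5.30a)
`‖w_o‖₀ ≤ (M/4) δ_{q+1}^{1/2}`): under the standing hypotheses with `C_in ≥ 0`, `c₀ > 0`, `a ≥ 1`
and `4δ_{q+2} ≤ δ_{q+1}λ_q^{-α}`, if the Mikado profile `W` is bounded by `K_W` on the ball
`‖R‖_∞ ≤ 9e^{8C_in}(1 + 8C_in)`, then `‖w_o(t,x)‖ ≤ (18 e^{8C_in} K_W / c₀^{1/2}) δ_{q+1}^{1/2}` on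
`[0,T] × T³`. [cite: BuckmasterEtAl2018, Cor. 5.8 (5.30a)] -/
theorem PerturbationData.norm_principalPart_le (H : CoreHypotheses P S Nbar Cin C₀)
    (𝒟 : PerturbationData P S c₀ Cη) (𝔚 : MikadoDatum mikadoRadius) (hc₀ : 0 < c₀) (hCin : 0 ≤ Cin)
    (ha : 1 ≤ P.a) (hb : 1 ≤ P.b) (hβ : 0 ≤ P.β) (hα : 0 ≤ P.α)
    (h4 : 4 * amp P.β P.a P.b (S.q + 2) ≤ amp P.β P.a P.b (S.q + 1) * freq P.a P.b S.q ^ (-P.α))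
    {KW : ℝ} (hKW0 : 0 ≤ KW)
    (hKW : ∀ R ∈ Metric.closedBall (0 : Matrix (Fin 3) (Fin 3) ℝ)
      (9 * Real.exp (8 * Cin) * (1 + 8 * Cin)), ∀ ξ : UnitAddTorus (Fin 3), ‖𝔚.W R ξ‖ ≤ KW)
    {t : ℝ} (ht : t ∈ Icc 0 S.T) (x : UnitAddTorus (Fin 3)) :
    ‖principalPart P S 𝔚 𝒟.cut.η 𝒟.D t x‖ ≤
      18 * Real.exp (8 * Cin) * KW / Real.sqrt c₀ * Real.sqrt (amp P.β P.a P.b (S.q + 1)) := by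
  set B : ℝ := 18 * Real.exp (8 * Cin) * KW / Real.sqrt c₀ * Real.sqrt (amp P.β P.a P.b (S.q + 1))
    with hB
  have hB0 : 0 ≤ B := by positivity
  refine 𝒟.cut.norm_sum_le t x hB0 (fun i hi => by rw [sqrtRhoI, hi, zero_mul, zero_smul]) ?_ _
  intro i
  by_cases hη : 𝒟.cut.η i t x = 0
  · rw [sqrtRhoI, hη, zero_mul, zero_smul, norm_zero]
    exact hB0
  · rw [norm_smul, Real.norm_eq_abs]
    have h1 := 𝒟.abs_sqrtRhoI_le H hc₀ ha ht i x
    have hG : ‖gradPhi 𝒟.D i t x‖ ≤ Real.exp (4 * Cin) :=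
      𝒟.norm_gradPhi_le H hCin ha hb hβ hα ht hη x
    have hadj : ‖(gradPhi 𝒟.D i t x).adjugate‖ ≤ 2 * Real.exp (8 * Cin) := by
      refine (norm_adjugate_le _).trans ?_
      have h2 : ‖gradPhi 𝒟.D i t x‖ ^ 2 ≤ Real.exp (4 * Cin) ^ 2 :=
        pow_le_pow_left₀ (norm_nonneg _) hG 2
      have h8 : Real.exp (4 * Cin) ^ 2 = Real.exp (8 * Cin) := by
        rw [← Real.exp_nat_mul]; ring_nf
      linarith
    have hRt : tildeR P S 𝒟.cut.η 𝒟.D i t x ∈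
        Metric.closedBall (0 : Matrix (Fin 3) (Fin 3) ℝ)
          (9 * Real.exp (8 * Cin) * (1 + 8 * Cin)) := by
      rw [Metric.mem_closedBall, dist_zero_right]
      exact 𝒟.norm_tildeR_le H hCin ha hb hβ hα h4 ht hη x
    have hWle := hKW _ hRt (P.freqNat (S.q + 1) • phiPoint 𝒟.D i t x)
    have h2 := norm_toEuclideanLin_le (gradPhi 𝒟.D i t x).adjugate
      (𝔚.W (tildeR P S 𝒟.cut.η 𝒟.D i t x) (P.freqNat (S.q + 1) • phiPoint 𝒟.D i t x))
    have h3 : 9 * ‖(gradPhi 𝒟.D i t x).adjugate‖ *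
        ‖𝔚.W (tildeR P S 𝒟.cut.η 𝒟.D i t x) (P.freqNat (S.q + 1) • phiPoint 𝒟.D i t x)‖ ≤
        9 * (2 * Real.exp (8 * Cin)) * KW :=
      mul_le_mul (mul_le_mul_of_nonneg_left hadj (by norm_num)) hWle (norm_nonneg _) (by positivity)
    have hsq : Real.sqrt (amp P.β P.a P.b (S.q + 1) / c₀) =
        Real.sqrt (amp P.β P.a P.b (S.q + 1)) / Real.sqrt c₀ := Real.sqrt_div (amp_pos ha _).le c₀
    calc |sqrtRhoI P S 𝒟.cut.η i t x| *
          ‖Matrix.toEuclideanLin (gradPhi 𝒟.D i t x).adjugate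
            (𝔚.W (tildeR P S 𝒟.cut.η 𝒟.D i t x) (P.freqNat (S.q + 1) • phiPoint 𝒟.D i t x))‖
        ≤ Real.sqrt (amp P.β P.a P.b (S.q + 1) / c₀) * (9 * (2 * Real.exp (8 * Cin)) * KW) :=
          mul_le_mul h1 (h2.trans h3) (norm_nonneg _) (Real.sqrt_nonneg _)
      _ = B := by rw [hB, hsq]; ring

end Principal

section SixSix

end SixSix

section Assembly

/-- **The corrector terms from Cor. 5.8** (BDSV, proof of Prop. 6.2, second estimate): the
named fact G₂ (`BDSV.energy_correctorTerm`: `|∫ 2w_o·w_c + |w_c|²| ≲ δ_{q+1} ℓ⁻¹ λ_{q+1}⁻¹`)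
follows from the corrector bound of Cor. 5.8 (`BDSV.correctorPartBound`, whose sup half
`‖w_c‖₀ ≤ C δ_{q+1}^{1/2} ℓ⁻¹ λ_{q+1}⁻¹` is used) and the proved sup bound on `w_o`: pointwise
`|2⟪w_o,w_c⟫ + |w_c|²| ≤ 2‖w_o‖‖w_c‖ + ‖w_c‖² ≤ (2KC + C²) δ_{q+1} ℓ⁻¹ λ_{q+1}⁻¹` using (6.6)
`ℓ⁻¹λ_{q+1}⁻¹ ≤ 1` on the square, then integrate (`T³` has measure one). Thresholds:
`α < min(α₀′, βb(b-1), (1-β)(b-1)/3)`, `a` beyond those of Cor. 5.8, of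
`4δ_{q+2} ≤ δ_{q+1}λ_q^{-α}` and of (6.6). [cite: BuckmasterEtAl2018, Prop. 6.2 (proof, second estimate)] -/
theorem energy_correctorTerm_of_correctorPartBound (h : correctorPartBound) :
    energy_correctorTerm := by
  intro 𝔚 c₀ hc₀ Cη β hβ hβ' b hb hb'
  obtain ⟨α₁, hα₁, h1⟩ := h 𝔚 c₀ hc₀ Cη β hβ hβ' b hb hb'
  have hb0 : (0 : ℝ) < b := by linarith
  have hb1 : (0 : ℝ) < b - 1 := by linarith
  have h1β : (0 : ℝ) < 1 - β := by linarith
  refine ⟨min α₁ (min (β * b * (b - 1)) ((1 - β) * (b - 1) / 3)),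
    lt_min hα₁ (lt_min (mul_pos (mul_pos hβ hb0) hb1) (div_pos (mul_pos h1β hb1) (by norm_num))),
    fun α hα hαlt => ?_⟩
  have hα1 : α < α₁ := lt_of_lt_of_le hαlt (min_le_left _ _)
  have hαb : α < 2 * β * b * (b - 1) := by
    have := lt_of_lt_of_le hαlt ((min_le_right _ _).trans (min_le_left _ _))
    nlinarith [mul_pos hβ hb0]
  have hα66 : 3 * α < 2 * (1 - β) * (b - 1) := by
    have := lt_of_lt_of_le hαlt ((min_le_right _ _).trans (min_le_right _ _))
    nlinarith [mul_pos h1β hb1]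
  obtain ⟨N₁, h1⟩ := h1 α hα hα1
  refine ⟨N₁, fun Cin C₀ => ?_⟩
  obtain ⟨C₁, a₁, ha₁, h1⟩ := h1 Cin C₀
  set Cp : ℝ := max Cin 0 with hCp
  have hCp0 : 0 ≤ Cp := le_max_right _ _
  obtain ⟨KW, hKW0, hKW⟩ := 𝔚.exists_bound_W
    (isCompact_closedBall (0 : Matrix (Fin 3) (Fin 3) ℝ) (9 * Real.exp (8 * Cp) * (1 + 8 * Cp)))
  set Ko : ℝ := 18 * Real.exp (8 * Cp) * KW / Real.sqrt c₀ with hKo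
  have hKo0 : 0 ≤ Ko := by rw [hKo]; positivity
  set C₁p : ℝ := max C₁ 0 with hC₁p
  have hC₁p0 : 0 ≤ C₁p := le_max_right _ _
  obtain ⟨a₄, ha₄, h4⟩ := exists_threshold_four_amp hb hαb
  obtain ⟨a₆, ha₆, h66⟩ := exists_threshold_mollScale_inv_mul_freq_inv_le_one hb.le hα66
  refine ⟨2 * Ko * C₁p + C₁p ^ 2, max a₁ (max a₄ a₆), lt_max_of_lt_left ha₁,
    fun a ha S H 𝒟 t ht => ?_⟩
  have haa₁ : a₁ ≤ a := (le_max_left _ _).trans ha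
  have haa₄ : a₄ ≤ a := ((le_max_left _ _).trans (le_max_right _ _)).trans ha
  have haa₆ : a₆ ≤ a := ((le_max_right _ _).trans (le_max_right _ _)).trans ha
  have ha1 : (1 : ℝ) ≤ a := ha₁.le.trans haa₁
  -- the scales
  set s : ℝ := Real.sqrt (amp β a b (S.q + 1)) with hs
  set L : ℝ := (mollScale β α a b S.q)⁻¹ * (freq a b (S.q + 1))⁻¹ with hL
  have hs0 : 0 ≤ s := Real.sqrt_nonneg _
  have hL0 : 0 ≤ L := mul_nonneg (inv_nonneg.2 (mollScale_pos ha1 _).le)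
    (inv_nonneg.2 (freq_pos ha1 _).le)
  have hL1 : L ≤ 1 := h66 a haa₆ S.q
  have hss : s * s = amp β a b (S.q + 1) := Real.mul_self_sqrt (amp_pos ha1 _).le
  -- sup bounds on `w_o` and `w_c`
  have H' : CoreHypotheses ⟨β, α, a, b⟩ S N₁ Cp C₀ := H.mono_const ha1 (le_max_left _ _)
  have hwo : ∀ x, ‖principalPart ⟨β, α, a, b⟩ S 𝔚 𝒟.cut.η 𝒟.D t x‖ ≤ Ko * s := fun x =>
    𝒟.norm_principalPart_le H' 𝔚 hc₀ hCp0 ha1 hb.le hβ.le hα.le (h4 a haa₄ S.q) hKW0 hKW ht x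
  have hwc : ∀ x, ‖correctorPart ⟨β, α, a, b⟩ S 𝔚 𝒟.cut.η 𝒟.D t x‖ ≤ C₁p * (s * L) := fun x =>
    calc ‖correctorPart ⟨β, α, a, b⟩ S 𝔚 𝒟.cut.η 𝒟.D t x‖
        ≤ C₁ * (s * (mollScale β α a b S.q)⁻¹ * (freq a b (S.q + 1))⁻¹) :=
          (h1 a haa₁ S H 𝒟).1 t ht x
      _ = C₁ * (s * L) := by rw [hL]; ring
      _ ≤ C₁p * (s * L) := mul_le_mul_of_nonneg_right (le_max_left _ _) (mul_nonneg hs0 hL0)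
  -- pointwise bound on the integrand
  have hpt : ∀ x, |2 * ⟪principalPart ⟨β, α, a, b⟩ S 𝔚 𝒟.cut.η 𝒟.D t x,
      correctorPart ⟨β, α, a, b⟩ S 𝔚 𝒟.cut.η 𝒟.D t x⟫_ℝ +
        ‖correctorPart ⟨β, α, a, b⟩ S 𝔚 𝒟.cut.η 𝒟.D t x‖ ^ 2| ≤
      (2 * Ko * C₁p + C₁p ^ 2) * (amp β a b (S.q + 1) * L) := by
    intro x
    have ho := hwo x
    have hc := hwc x
    have hin := abs_real_inner_le_norm (principalPart ⟨β, α, a, b⟩ S 𝔚 𝒟.cut.η 𝒟.D t x)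
      (correctorPart ⟨β, α, a, b⟩ S 𝔚 𝒟.cut.η 𝒟.D t x)
    have hprod : ‖principalPart ⟨β, α, a, b⟩ S 𝔚 𝒟.cut.η 𝒟.D t x‖ *
        ‖correctorPart ⟨β, α, a, b⟩ S 𝔚 𝒟.cut.η 𝒟.D t x‖ ≤ Ko * s * (C₁p * (s * L)) :=
      mul_le_mul ho hc (norm_nonneg _) (mul_nonneg hKo0 hs0)
    have hsq : ‖correctorPart ⟨β, α, a, b⟩ S 𝔚 𝒟.cut.η 𝒟.D t x‖ ^ 2 ≤ (C₁p * (s * L)) ^ 2 :=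
      pow_le_pow_left₀ (norm_nonneg _) hc 2
    have hsq' : (C₁p * (s * L)) ^ 2 ≤ C₁p ^ 2 * (amp β a b (S.q + 1) * L) := by
      have e : (C₁p * (s * L)) ^ 2 = C₁p ^ 2 * (amp β a b (S.q + 1) * L) * L := by
        rw [← hss]; ring
      rw [e]
      exact mul_le_of_le_one_right
        (mul_nonneg (sq_nonneg _) (mul_nonneg (amp_pos ha1 _).le hL0)) hL1
    have hp2 : Ko * s * (C₁p * (s * L)) = Ko * C₁p * (amp β a b (S.q + 1) * L) := by
      rw [← hss]; ring
    rw [abs_le]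
    obtain ⟨hin1, hin2⟩ := abs_le.mp hin
    constructor <;> nlinarith [sq_nonneg ‖correctorPart ⟨β, α, a, b⟩ S 𝔚 𝒟.cut.η 𝒟.D t x‖]
  -- integrate
  have hI := abs_integral_le_of_abs_le hpt
  calc |∫ x, (2 * ⟪principalPart ⟨β, α, a, b⟩ S 𝔚 𝒟.cut.η 𝒟.D t x,
        correctorPart ⟨β, α, a, b⟩ S 𝔚 𝒟.cut.η 𝒟.D t x⟫_ℝ +
          ‖correctorPart ⟨β, α, a, b⟩ S 𝔚 𝒟.cut.η 𝒟.D t x‖ ^ 2)|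
      ≤ (2 * Ko * C₁p + C₁p ^ 2) * (amp β a b (S.q + 1) * L) := hI
    _ = (2 * Ko * C₁p + C₁p ^ 2) * (amp β a b (S.q + 1) * (mollScale β α a b S.q)⁻¹ *
        (freq a b (S.q + 1))⁻¹) := by rw [hL]; ring

end Assembly

end DeRosa

/-! ## Port of `OnsagerBDSVEnergyCorrectorHolds` -/

namespace DeRosa

open BDSV

open FunctionSpaces FunctionSpaces.Torus

/-- The flat three-torus `T³ = (ℝ/ℤ)³`, local notation. -/
local notation "𝕋³" => UnitAddTorus (Fin 3)

/-- Euclidean `ℝ³`, local notation. -/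
local notation "ℝ³" => EuclideanSpace ℝ (Fin 3)

/-- Real `3 × 3` matrices, local notation. -/
local notation "𝕄" => Matrix (Fin 3) (Fin 3) ℝ

/-- Continuous linear endomorphisms of `ℝ³`, local notation. -/
local notation "𝕃" => (EuclideanSpace ℝ (Fin 3) →L[ℝ] EuclideanSpace ℝ (Fin 3))

section Bridge

variable {F : Type*} [NormedAddCommGroup F] [NormedSpace ℝ F]

/-- A bound `‖g‖_{C^{k,r}} ≤ B` (`B ≥ 0`) bounds the derivatives of the periodic lift:
`‖Dʲ(lift g)(y)‖ ≤ B` for `j ≤ k` (a local variant of the lemma of the same content in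
`OnsagerBDSVGluingProofs.lean`, whose import closure is not wanted here). [folklore] -/
private theorem norm_iteratedFDeriv_lift_le_of_holder_le {g : 𝕋³ → F} {k j : ℕ} (hj : j ≤ k)
    {r : ℝ≥0} {B : ℝ} (hB : 0 ≤ B) (h : Torus.eContDiffHolderNorm k r g ≤ ENNReal.ofReal B)
    (y : ℝ³) : ‖iteratedFDeriv ℝ j (lift g) y‖ ≤ B := by
  have h1 : ‖iteratedFDeriv ℝ j (lift g) y‖ₑ ≤ ENNReal.ofReal B := by
    refine le_trans ((enorm_le_eSupNorm _ y).trans ?_) h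
    unfold Torus.eContDiffHolderNorm FunctionSpaces.eContDiffHolderNorm
    refine le_add_right ?_
    exact Finset.single_le_sum (f := fun j => eSupNorm (iteratedFDeriv ℝ j (lift g)))
      (fun _ _ => zero_le) (Finset.mem_range.2 (Nat.lt_succ_of_le hj))
  rwa [← ofReal_norm, ENNReal.ofReal_le_ofReal_iff hB] at h1

end Bridge

section MikadoBall

end MikadoBall

section Ingredients

variable {P : Params} {S : Setting} {Nbar : ℕ} {Cin C₀ c₀ : ℝ} {Cη : ℕ → ℕ → ℝ}

/-- (2.19): `‖Dʲ(lift v̄_q(s))‖ ≤ C_in δ_q^{1/2} λ_q ℓ^{-N}` for `j ≤ N + 1`, `N ≤ N̄` (`C_in ≥ 0`,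
`a ≥ 1`). [cite: BuckmasterEtAl2018, §2.5 (2.19)] -/
theorem CoreHypotheses.norm_iteratedFDeriv_lift_vbar_le (H : CoreHypotheses P S Nbar Cin C₀)
    (hCin : 0 ≤ Cin) (ha : 1 ≤ P.a) {N : ℕ} (hN : N ≤ Nbar) {j : ℕ} (hj : j ≤ N + 1) {s : ℝ}
    (hs : s ∈ Icc 0 S.T) (y : ℝ³) :
    ‖iteratedFDeriv ℝ j (lift (S.vbar s)) y‖ ≤
      Cin * (Real.sqrt (amp P.β P.a P.b S.q) * freq P.a P.b S.q *
        mollScale P.β P.α P.a P.b S.q ^ (-(N : ℝ))) :=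
  norm_iteratedFDeriv_lift_le_of_holder_le hj
    (mul_nonneg hCin (mul_nonneg (mul_nonneg (Real.sqrt_nonneg _) (freq_pos ha _).le)
      (Real.rpow_nonneg (mollScale_pos ha _).le _))) (H.velocity N hN s hs) y

/-- (2.20): `‖Dʲ(lift R̊̄_q(s))‖ ≤ C_in δ_{q+1} ℓ^{-N+α}` for `j ≤ N ≤ N̄` (`C_in ≥ 0`, `a ≥ 1`).
[cite: BuckmasterEtAl2018, §2.5 (2.20)] -/
theorem CoreHypotheses.norm_iteratedFDeriv_lift_Rbar_le (H : CoreHypotheses P S Nbar Cin C₀)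
    (hCin : 0 ≤ Cin) (ha : 1 ≤ P.a) {N : ℕ} (hN : N ≤ Nbar) {j : ℕ} (hj : j ≤ N) {s : ℝ}
    (hs : s ∈ Icc 0 S.T) (y : ℝ³) :
    ‖iteratedFDeriv ℝ j (lift (S.Rbar s)) y‖ ≤
      Cin * (amp P.β P.a P.b (S.q + 1) * mollScale P.β P.α P.a P.b S.q ^ (-(N : ℝ) + P.α)) :=
  norm_iteratedFDeriv_lift_le_of_holder_le hj
    (mul_nonneg hCin (mul_nonneg (amp_pos ha _).le (Real.rpow_nonneg (mollScale_pos ha _).le _)))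
    (H.stress N hN s hs) y

/-- `(ρ_q/∑∫η_j²)^{1/2} ≤ (δ_{q+1}/c₀)^{1/2}` on `[0,T]` (Lemma 5.4: `ρ_q ≤ δ_{q+1}`, `∑∫η_j² ≥ c₀`).
[cite: BuckmasterEtAl2018, Lemma 5.4 (5.15)–(5.16)] -/
theorem PerturbationData.sqrt_rhoQ_div_etaMass_le (H : CoreHypotheses P S Nbar Cin C₀)
    (𝒟 : PerturbationData P S c₀ Cη) (hc₀ : 0 < c₀) (ha : 1 ≤ P.a) {t : ℝ} (ht : t ∈ Icc 0 S.T) :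
    Real.sqrt (rhoQ P S t / etaMass P S 𝒟.cut.η t) ≤ Real.sqrt (amp P.β P.a P.b (S.q + 1) / c₀) := by
  have hm : c₀ ≤ etaMass P S 𝒟.cut.η t := 𝒟.le_etaMass ht
  have hm0 : 0 < etaMass P S 𝒟.cut.η t := hc₀.trans_le hm
  refine Real.sqrt_le_sqrt ?_
  calc rhoQ P S t / etaMass P S 𝒟.cut.η t
      ≤ amp P.β P.a P.b (S.q + 1) / etaMass P S 𝒟.cut.η t :=
        div_le_div_of_nonneg_right (H.rhoQ_le ha ht) hm0.le
    _ ≤ amp P.β P.a P.b (S.q + 1) / c₀ := div_le_div_of_nonneg_left (amp_pos ha _).le hc₀ hm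

/-- `0 ≤ ∑∫η_j²/ρ_q ≤ 8λ_q^α/δ_{q+1}` on `[0,T]`, given `4δ_{q+2} ≤ δ_{q+1}λ_q^{-α}` (Lemma 5.4:
`ρ_q ≥ δ_{q+1}λ_q^{-α}/8`, `∑∫η_j² ≤ 1`). [cite: BuckmasterEtAl2018, Lemma 5.4 (5.15), (5.19)] -/
private theorem PerturbationData.etaMass_div_rhoQ_bounds (H : CoreHypotheses P S Nbar Cin C₀)
    (𝒟 : PerturbationData P S c₀ Cη) (ha : 1 ≤ P.a)
    (h4 : 4 * amp P.β P.a P.b (S.q + 2) ≤ amp P.β P.a P.b (S.q + 1) * freq P.a P.b S.q ^ (-P.α))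
    {t : ℝ} (ht : t ∈ Icc 0 S.T) :
    0 ≤ etaMass P S 𝒟.cut.η t / rhoQ P S t ∧
      etaMass P S 𝒟.cut.η t / rhoQ P S t ≤ 8 * freq P.a P.b S.q ^ P.α / amp P.β P.a P.b (S.q + 1) := by
  have hδ : 0 < amp P.β P.a P.b (S.q + 1) := amp_pos ha _
  have hfr : 0 < freq P.a P.b S.q ^ (-P.α) := Real.rpow_pos_of_pos (freq_pos ha _) _
  have hρ : amp P.β P.a P.b (S.q + 1) * freq P.a P.b S.q ^ (-P.α) / 8 ≤ rhoQ P S t := H.le_rhoQ h4 ht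
  have hρ0 : 0 < rhoQ P S t := lt_of_lt_of_le (by positivity) hρ
  have hS1 : etaMass P S 𝒟.cut.η t ≤ 1 := 𝒟.etaMass_le_one ht
  have hS0 : 0 ≤ etaMass P S 𝒟.cut.η t :=
    Finset.sum_nonneg fun j _ => integral_nonneg fun y => sq_nonneg _
  refine ⟨div_nonneg hS0 hρ0.le, ?_⟩
  rw [div_le_div_iff₀ hρ0 hδ]
  have h2 : 8 * freq P.a P.b S.q ^ P.α * (amp P.β P.a P.b (S.q + 1) * freq P.a P.b S.q ^ (-P.α) / 8) =
      amp P.β P.a P.b (S.q + 1) := by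
    have : freq P.a P.b S.q ^ P.α * freq P.a P.b S.q ^ (-P.α) = 1 := by
      rw [← Real.rpow_add (freq_pos ha _), add_neg_cancel, Real.rpow_zero]
    calc 8 * freq P.a P.b S.q ^ P.α * (amp P.β P.a P.b (S.q + 1) * freq P.a P.b S.q ^ (-P.α) / 8)
        = amp P.β P.a P.b (S.q + 1) * (freq P.a P.b S.q ^ P.α * freq P.a P.b S.q ^ (-P.α)) := by ring
      _ = _ := by rw [this, mul_one]
  calc etaMass P S 𝒟.cut.η t * amp P.β P.a P.b (S.q + 1) ≤ amp P.β P.a P.b (S.q + 1) := by nlinarith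
    _ = 8 * freq P.a P.b S.q ^ P.α * (amp P.β P.a P.b (S.q + 1) * freq P.a P.b S.q ^ (-P.α) / 8) :=
        h2.symm
    _ ≤ 8 * freq P.a P.b S.q ^ P.α * rhoQ P S t :=
        mul_le_mul_of_nonneg_left hρ (mul_nonneg (by norm_num) (Real.rpow_nonneg (freq_pos ha _).le _))

/-- **Deformation bounds on the support of the cut-offs** (Lemma 5.4 (5.14) and Prop. 5.7 (5.33)
at order one, via App. B (B.4)–(B.5) = `BDSV.norm_gradField_le`, `BDSV.norm_gradField_two_le`):
under the standing hypotheses with `N̄ ≥ 1` and the threshold `exp(4C_inℓ^{2α}) - 1 ≤ 1/300`, if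
`ηᵢ(t, ·) ≠ 0` somewhere then `‖D(lift Dᵢ(t))‖ ≤ 1/300` and `‖D²(lift Dᵢ(t))‖ ≤ ℓ⁻¹` everywhere
(`|t - tᵢ*| ≤ 4τ_q/3`, `C_in δ_q^{1/2}λ_q τ_q = C_in ℓ^{2α}`, `‖v̄_q‖₂ ≤ C_in δ_q^{1/2}λ_q ℓ⁻¹`).
[cite: BuckmasterEtAl2018, Lemma 5.4 (5.14) and Prop. 5.7 (5.33)] -/
theorem PerturbationData.norm_fderiv_lift_D_le (H : CoreHypotheses P S Nbar Cin C₀)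
    (𝒟 : PerturbationData P S c₀ Cη) (hCin : 0 ≤ Cin) (ha : 1 ≤ P.a) (hNbar : 1 ≤ Nbar)
    (hdef : Real.exp (4 * (Cin * mollScale P.β P.α P.a P.b S.q ^ (2 * P.α))) - 1 ≤ 1 / 300)
    {i : ℕ} {t : ℝ} (ht : t ∈ Icc 0 S.T) {x' : 𝕋³} (hη : 𝒟.cut.η i t x' ≠ 0) (y : ℝ³) :
    ‖fderiv ℝ (lift (𝒟.D i t)) y‖ ≤ 1 / 300 ∧
      ‖fderiv ℝ (fderiv ℝ (lift (𝒟.D i t))) y‖ ≤ (mollScale P.β P.α P.a P.b S.q)⁻¹ := by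
  set ℓ := mollScale P.β P.α P.a P.b S.q with hℓdef
  have hℓ : 0 < ℓ := mollScale_pos ha _
  set K₁ : ℝ := Cin * (Real.sqrt (amp P.β P.a P.b S.q) * freq P.a P.b S.q) with hK₁def
  have hK₁ : 0 ≤ K₁ := mul_nonneg hCin (mul_nonneg (Real.sqrt_nonneg _) (freq_pos ha _).le)
  have hK₂ : 0 ≤ K₁ * ℓ⁻¹ := mul_nonneg hK₁ (inv_nonneg.2 hℓ.le)
  -- bounds on `∇v̄`, `∇²v̄`
  have hb₁ : ∀ s ∈ Icc 0 S.T, ∀ x, ‖gradField S.vbar s x‖ ≤ K₁ := by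
    refine forall_norm_gradField_le_of_lift fun s hs z => ?_
    have h := H.norm_iteratedFDeriv_lift_vbar_le hCin ha (N := 0) (Nat.zero_le _) (j := 1) le_rfl hs z
    simp only [Nat.cast_zero, neg_zero, Real.rpow_zero, mul_one] at h
    exact h
  have hb₂ : ∀ s ∈ Icc 0 S.T, ∀ x, ‖gradField (gradField S.vbar) s x‖ ≤ K₁ * ℓ⁻¹ := by
    refine forall_norm_gradField_two_le_of_lift fun s hs z => ?_
    have h := H.norm_iteratedFDeriv_lift_vbar_le hCin ha (N := 1) hNbar (j := 2) le_rfl hs z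
    rw [Nat.cast_one, Real.rpow_neg_one] at h
    rw [hK₁def, mul_assoc]
    exact h
  -- time localisation and the CFL-type condition
  have hτ : 0 < P.τ S.q := glueScale_pos ha S.q
  have hanchor : min ((i : ℝ) * P.τ S.q) S.T ∈ Icc 0 S.T :=
    ⟨le_min (mul_nonneg i.cast_nonneg hτ.le) H.pos_T.le, min_le_right _ _⟩
  have hdt : |t - min ((i : ℝ) * P.τ S.q) S.T| ≤ 4 * P.τ S.q / 3 :=
    CutoffFamily.abs_sub_anchor_le hτ 𝒟.cut ht hη
  have hKτ : K₁ * P.τ S.q = Cin * ℓ ^ (2 * P.α) := velocityBound_mul_tau ha S.q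
  have hCℓ : 4 * (Cin * ℓ ^ (2 * P.α)) ≤ 1 / 300 := by
    linarith [Real.add_one_le_exp (4 * (Cin * ℓ ^ (2 * P.α)))]
  have hdtK : |t - min ((i : ℝ) * P.τ S.q) S.T| * K₁ ≤ 4 / 3 * (Cin * ℓ ^ (2 * P.α)) :=
    calc |t - min ((i : ℝ) * P.τ S.q) S.T| * K₁ ≤ 4 * P.τ S.q / 3 * K₁ :=
          mul_le_mul_of_nonneg_right hdt hK₁
      _ = 4 / 3 * (K₁ * P.τ S.q) := by ring
      _ = 4 / 3 * (Cin * ℓ ^ (2 * P.α)) := by rw [hKτ]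
  have hCFL : |t - min ((i : ℝ) * P.τ S.q) S.T| * K₁ ≤ 1 := by linarith
  have htr := fun s (hs : s ∈ Icc 0 S.T) x => (𝒟.flow i).advectiveDeriv_eq hs x
  have h1 := norm_gradField_le H.pos_T H.eulerReynolds.smooth_velocity (𝒟.flow i).smooth htr hanchor
    (𝒟.flow i).anchor hK₁ hb₁ ht hCFL (proj y)
  have h2 := norm_gradField_two_le H.pos_T H.eulerReynolds.smooth_velocity (𝒟.flow i).smooth htr
    hanchor (𝒟.flow i).anchor hK₁ hK₂ hb₁ hb₂ ht hCFL (proj y)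
  refine ⟨?_, ?_⟩
  · rw [fderiv_lift]
    calc ‖Torus.fderiv (𝒟.D i t) (proj y)‖ ≤ 3 * K₁ * |t - min ((i : ℝ) * P.τ S.q) S.T| := h1
      _ ≤ 1 / 300 := by nlinarith
  · rw [← norm_iteratedFDeriv_two_eq_norm_fderiv_fderiv, norm_iteratedFDeriv_lift_two]
    calc ‖Torus.fderiv (fun x => Torus.fderiv (𝒟.D i t) x) (proj y)‖
        ≤ 32 * (K₁ * ℓ⁻¹) * |t - min ((i : ℝ) * P.τ S.q) S.T| := h2
      _ = 32 * (|t - min ((i : ℝ) * P.τ S.q) S.T| * K₁) * ℓ⁻¹ := by ring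
      _ ≤ 32 * (4 / 3 * (Cin * ℓ ^ (2 * P.α))) * ℓ⁻¹ := by gcongr
      _ ≤ ℓ⁻¹ := by
          have : 0 ≤ ℓ⁻¹ := inv_nonneg.2 hℓ.le
          nlinarith

end Ingredients

section SupBounds

variable {P : Params} {S : Setting} {Nbar : ℕ} {Cin C₀ c₀ : ℝ} {Cη : ℕ → ℕ → ℝ}

variable {𝔚 : MikadoDatum mikadoRadius} {η : ℕ → ℝ → 𝕋³ → ℝ} {D : ℕ → ℝ → 𝕋³ → ℝ³} {i : ℕ} {t : ℝ}

/-- **The ingredient bounds at an active index** (`ηᵢ(t, proj y) ≠ 0`): `‖D(lift Dᵢ)‖ ≤ 1`,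
`‖D²(lift Dᵢ)‖ ≤ ℓ⁻¹`, `R̃_{q,i}` in the Mikado ball (matrix and carrier form), and
`‖DR̃_{q,i}‖ ≤ 9‖T‖ℓ⁻¹` ((5.32)–(5.33) with `‖∇R̊̄_q‖ ≤ C_inδ_{q+1}ℓ^{-1+α}`, `∑∫η²/ρ_q ≤ 8λ_q^α/δ_{q+1}`
and `800(1 + ‖ofCols‖)C_in(λ_qℓ)^α ≤ 1`). [cite: BuckmasterEtAl2018, Lemma 5.4 and Prop. 5.7 (5.32)–(5.33)] -/
theorem PerturbationData.active_bounds (H : CoreHypotheses P S Nbar Cin C₀)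
    (𝒟 : PerturbationData P S c₀ Cη) (hCin : 0 ≤ Cin) (ha : 1 ≤ P.a) (hNbar : 1 ≤ Nbar)
    (h4 : 4 * amp P.β P.a P.b (S.q + 2) ≤ amp P.β P.a P.b (S.q + 1) * freq P.a P.b S.q ^ (-P.α))
    (hdef : Real.exp (4 * (Cin * mollScale P.β P.α P.a P.b S.q ^ (2 * P.α))) - 1 ≤ 1 / 300)
    (hstr : 800 * (1 + ‖ofColsCL‖) * Cin *
      (freq P.a P.b S.q ^ P.α * mollScale P.β P.α P.a P.b S.q ^ P.α) ≤ 1)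
    {i : ℕ} {t : ℝ} (ht : t ∈ Icc 0 S.T) {y : ℝ³} (hη : 𝒟.cut.η i t (proj y) ≠ 0) :
    ‖fderiv ℝ (lift (𝒟.D i t)) y‖ ≤ 1 ∧
    ‖fderiv ℝ (fderiv ℝ (lift (𝒟.D i t))) y‖ ≤ (mollScale P.β P.α P.a P.b S.q)⁻¹ ∧
    tildeR P S 𝒟.cut.η 𝒟.D i t (proj y) ∈ Metric.closedBall (1 : 𝕄) mikadoRadius ∧
    stressCL (etaMass P S 𝒟.cut.η t / rhoQ P S t) (S.Rbar t) (𝒟.D i t) y ∈ mikadoBallCL ∧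
    ‖fderiv ℝ (stressCL (etaMass P S 𝒟.cut.η t / rhoQ P S t) (S.Rbar t) (𝒟.D i t)) y‖ ≤
      9 * ‖transposeCL‖ * (mollScale P.β P.α P.a P.b S.q)⁻¹ := by
  set ℓ := mollScale P.β P.α P.a P.b S.q with hℓdef
  have hℓ : 0 < ℓ := mollScale_pos ha _
  have hℓi : 0 ≤ ℓ⁻¹ := inv_nonneg.2 hℓ.le
  set X : ℝ := freq P.a P.b S.q ^ P.α * ℓ ^ P.α with hXdef
  have hX : 0 ≤ X := mul_nonneg (Real.rpow_nonneg (freq_pos ha _).le _) (Real.rpow_nonneg hℓ.le _)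
  set o : ℝ := ‖ofColsCL‖ with hodef
  have ho : 0 ≤ o := norm_nonneg ofColsCL
  set θ : ℝ := ‖transposeCL‖ with hθdef
  have hθ : 0 ≤ θ := norm_nonneg transposeCL
  -- consequences of the stress threshold
  have hCX : Cin * X ≤ (1 + o) * (Cin * X) := le_mul_of_one_le_left (mul_nonneg hCin hX) (by linarith)
  have hstr' : 8 * (Cin * X) ≤ 1 / 100 := by nlinarith
  have hoX : 8 * o * Cin * X ≤ 1 / 100 := by nlinarith [mul_nonneg ho (mul_nonneg hCin hX)]
  -- the deformation bounds
  obtain ⟨hd1, hd2⟩ := 𝒟.norm_fderiv_lift_D_le H hCin ha hNbar hdef ht hη y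
  have hd1' : ‖fderiv ℝ (lift (𝒟.D i t)) y‖ ≤ 1 := hd1.trans (by norm_num)
  -- the Mikado ball
  have hballR : tildeR P S 𝒟.cut.η 𝒟.D i t (proj y) ∈ Metric.closedBall (1 : 𝕄) mikadoRadius :=
    𝒟.tildeR_mem_closedBall H hCin ha hdef hstr' h4 ht hη (proj y)
  have hDs : IsSmooth (𝒟.D i t) := (𝒟.flow i).smooth.isSmooth_slice ht
  have hRs : IsSmooth (S.Rbar t) := H.eulerReynolds.smooth_stress.isSmooth_slice ht
  have hD1 : IsContDiff 1 (𝒟.D i t) := hDs.isContDiff (by simp)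
  have hlt : liftTildeR (etaMass P S 𝒟.cut.η t / rhoQ P S t) (S.Rbar t) (𝒟.D i t) y =
      tildeR P S 𝒟.cut.η 𝒟.D i t (proj y) := by
    have h := congrFun (lift_tildeR (P := P) (S := S) (η := 𝒟.cut.η) (D := 𝒟.D) (i := i) (t := t) hD1) y
    rw [lift_apply] at h
    exact h.symm
  have hK : stressCL (etaMass P S 𝒟.cut.η t / rhoQ P S t) (S.Rbar t) (𝒟.D i t) y ∈ mikadoBallCL :=
    stressCL_mem_mikadoBallCL (hlt ▸ hballR)
  -- the derivative of `R̃`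
  obtain ⟨hc0, hc⟩ := 𝒟.etaMass_div_rhoQ_bounds H ha h4 ht
  have hδ : 0 < amp P.β P.a P.b (S.q + 1) := amp_pos ha _
  have hr0 : ‖lift (S.Rbar t) y‖ ≤ Cin * (amp P.β P.a P.b (S.q + 1) * ℓ ^ P.α) := by
    have h := H.norm_iteratedFDeriv_lift_Rbar_le hCin ha (N := 0) (Nat.zero_le _) (j := 0) le_rfl ht y
    simp only [Nat.cast_zero, neg_zero, zero_add, norm_iteratedFDeriv_zero] at h
    exact h
  have hr1 : ‖iteratedFDeriv ℝ 1 (lift (S.Rbar t)) y‖ ≤ Cin * (amp P.β P.a P.b (S.q + 1) * ℓ ^ (-1 + P.α)) := by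
    have h := H.norm_iteratedFDeriv_lift_Rbar_le hCin ha (N := 1) hNbar (j := 1) le_rfl ht y
    rw [Nat.cast_one] at h
    exact h
  have hcr0 : |etaMass P S 𝒟.cut.η t / rhoQ P S t| * o * ‖lift (S.Rbar t) y‖ ≤ 1 := by
    rw [abs_of_nonneg hc0]
    calc etaMass P S 𝒟.cut.η t / rhoQ P S t * o * ‖lift (S.Rbar t) y‖
        ≤ (8 * freq P.a P.b S.q ^ P.α / amp P.β P.a P.b (S.q + 1)) * o *
            (Cin * (amp P.β P.a P.b (S.q + 1) * ℓ ^ P.α)) :=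
          mul_le_mul (mul_le_mul_of_nonneg_right hc ho) hr0 (norm_nonneg _)
            (mul_nonneg (div_nonneg (mul_nonneg (by norm_num) (Real.rpow_nonneg (freq_pos ha _).le _)) hδ.le) ho)
      _ = 8 * o * Cin * X := by rw [hXdef]; field_simp
      _ ≤ 1 := hoX.trans (by norm_num)
  have hcr1 : |etaMass P S 𝒟.cut.η t / rhoQ P S t| * o * ‖iteratedFDeriv ℝ 1 (lift (S.Rbar t)) y‖ ≤
      1 / 100 * ℓ⁻¹ := by
    rw [abs_of_nonneg hc0]
    calc etaMass P S 𝒟.cut.η t / rhoQ P S t * o * ‖iteratedFDeriv ℝ 1 (lift (S.Rbar t)) y‖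
        ≤ (8 * freq P.a P.b S.q ^ P.α / amp P.β P.a P.b (S.q + 1)) * o *
            (Cin * (amp P.β P.a P.b (S.q + 1) * ℓ ^ (-1 + P.α))) :=
          mul_le_mul (mul_le_mul_of_nonneg_right hc ho) hr1 (norm_nonneg _)
            (mul_nonneg (div_nonneg (mul_nonneg (by norm_num) (Real.rpow_nonneg (freq_pos ha _).le _)) hδ.le) ho)
      _ = 8 * o * Cin * X * ℓ⁻¹ := by
          rw [hXdef, Real.rpow_add hℓ, Real.rpow_neg_one]
          field_simp
      _ ≤ 1 / 100 * ℓ⁻¹ := mul_le_mul_of_nonneg_right hoX hℓi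
  have hst := (norm_iteratedFDeriv_stressCL_le (etaMass P S 𝒟.cut.η t / rhoQ P S t) hRs hDs y
    (by rw [norm_iteratedFDeriv_one_eq_norm_fderiv]; exact hd1') hcr0).1
  rw [norm_iteratedFDeriv_one_eq_norm_fderiv, norm_iteratedFDeriv_two_eq_norm_fderiv_fderiv] at hst
  refine ⟨hd1', hd2, hballR, hK, hst.trans ?_⟩
  rw [← hθdef, ← hodef]
  calc θ * (8 * ‖fderiv ℝ (fderiv ℝ (lift (𝒟.D i t))) y‖ +
        4 * (|etaMass P S 𝒟.cut.η t / rhoQ P S t| * o * ‖iteratedFDeriv ℝ 1 (lift (S.Rbar t)) y‖))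
      ≤ θ * (8 * ℓ⁻¹ + 4 * (1 / 100 * ℓ⁻¹)) := by gcongr
    _ ≤ 9 * θ * ℓ⁻¹ := by nlinarith [mul_nonneg hθ hℓi]

/-- **Sup bound on the principal part** (Cor. 5.8 (5.29) in crude form:
`‖w_o(x,t)‖ ≤ 4‖BDSV.curl‖‖T‖C_V (δ_{q+1}/c₀)^{1/2}` — at most one cut-off is active, and for it
`n w_{o,i} = BDSV.curl[fastᵢ]` with `‖fastᵢ‖ ≤ 4n‖T‖C_V ρ_{q,i}^{1/2}`, `ρ_{q,i}^{1/2} ≤ (δ_{q+1}/c₀)^{1/2}`).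
[cite: BuckmasterEtAl2018, Cor. 5.8 (5.29)] -/
theorem PerturbationData.principalPart_sup_le (H : CoreHypotheses P S Nbar Cin C₀)
    (𝒟 : PerturbationData P S c₀ Cη) (𝔚 : MikadoDatum mikadoRadius) (hc₀ : 0 < c₀) (hCin : 0 ≤ Cin)
    (ha : 1 ≤ P.a) (hNbar : 1 ≤ Nbar)
    (h4 : 4 * amp P.β P.a P.b (S.q + 2) ≤ amp P.β P.a P.b (S.q + 1) * freq P.a P.b S.q ^ (-P.α))
    (hdef : Real.exp (4 * (Cin * mollScale P.β P.α P.a P.b S.q ^ (2 * P.α))) - 1 ≤ 1 / 300)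
    (hstr : 800 * (1 + ‖ofColsCL‖) * Cin *
      (freq P.a P.b S.q ^ P.α * mollScale P.β P.α P.a P.b S.q ^ P.α) ≤ 1)
    {CV : ℝ} (hCV0 : 0 ≤ CV)
    (hCV : ∀ m ≤ 1, ∀ T ∈ mikadoBallCL, ∀ ξ : ℝ³, ‖iteratedFDeriv ℝ m (mikadoLiftCL 𝔚.V) (T, ξ)‖ ≤ CV)
    {t : ℝ} (ht : t ∈ Icc 0 S.T) (x : 𝕋³) :
    ‖principalPart P S 𝔚 𝒟.cut.η 𝒟.D t x‖ ≤
      4 * ‖curlCLM‖ * ‖transposeCL‖ * CV * Real.sqrt (amp P.β P.a P.b (S.q + 1) / c₀) := by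
  obtain ⟨y, rfl⟩ := proj_surjective x
  set B := 4 * ‖curlCLM‖ * ‖transposeCL‖ * CV * Real.sqrt (amp P.β P.a P.b (S.q + 1) / c₀) with hBdef
  have hKc : 0 ≤ ‖curlCLM‖ := norm_nonneg curlCLM
  have hθ : 0 ≤ ‖transposeCL‖ := norm_nonneg transposeCL
  have hB0 : 0 ≤ B := by positivity
  have hn0 : (0 : ℝ) < P.freqNat (S.q + 1) := Nat.cast_pos.2 (P.freqNat_pos ha _)
  have hηs : ∀ j, IsSmooth (𝒟.cut.η j t) := fun j => (𝒟.cut.smooth j).isSmooth_slice ht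
  have hRs : IsSmooth (S.Rbar t) := H.eulerReynolds.smooth_stress.isSmooth_slice ht
  have hDs : ∀ j, IsSmooth (𝒟.D j t) := fun j => (𝒟.flow j).smooth.isSmooth_slice ht
  have hsymm := H.eulerReynolds.symm t ht
  have hσ0 : 0 ≤ Real.sqrt (rhoQ P S t / etaMass P S 𝒟.cut.η t) := Real.sqrt_nonneg _
  have hσ := 𝒟.sqrt_rhoQ_div_etaMass_le H hc₀ ha ht
  rw [principalPart]
  refine 𝒟.cut.norm_sum_le t (proj y) hB0 (fun j hj0 => by rw [sqrtRhoI, hj0, zero_mul, zero_smul])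
    (fun j => ?_) _
  by_cases hne : 𝒟.cut.η j t (proj y) = 0
  · rw [sqrtRhoI, hne, zero_mul, zero_smul, norm_zero]
    exact hB0
  · obtain ⟨hd1, -, hballR, hK, -⟩ := 𝒟.active_bounds H hCin ha hNbar h4 hdef hstr ht hne
    have he := 𝒟.norm_fderiv_lift_eta_le j ht y
    have hV1 : ‖fderiv ℝ (mikadoLiftCL 𝔚.V) (stressCL (etaMass P S 𝒟.cut.η t / rhoQ P S t) (S.Rbar t)
        (𝒟.D j t) y, (P.freqNat (S.q + 1) : ℝ) • (y + lift (𝒟.D j t) y))‖ ≤ CV := by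
      have h := hCV 1 le_rfl _ hK ((P.freqNat (S.q + 1) : ℝ) • (y + lift (𝒟.D j t) y))
      rwa [norm_iteratedFDeriv_one_eq_norm_fderiv] at h
    have hid := smul_principalSummand_eq (P := P) (S := S) (𝔚 := 𝔚) (hηs j) hRs (hDs j) hsymm
      (fun _ => hballR)
    have hfast := norm_fastDeriv_le 𝔚.contDiff_mikadoLift_V hσ0 hn0.le he.1 hd1 hV1
    rw [← inv_smul_smul₀ hn0.ne' (sqrtRhoI P S 𝒟.cut.η j t (proj y) • _), hid, norm_smul, norm_inv,
      Real.norm_natCast]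
    calc ((P.freqNat (S.q + 1) : ℝ))⁻¹ * ‖curlCLM (fastDeriv 𝔚.V (Real.sqrt (rhoQ P S t / etaMass P S 𝒟.cut.η t))
          (etaMass P S 𝒟.cut.η t / rhoQ P S t) (P.freqNat (S.q + 1)) (𝒟.cut.η j t) (S.Rbar t) (𝒟.D j t) y)‖
        ≤ ((P.freqNat (S.q + 1) : ℝ))⁻¹ * (‖curlCLM‖ * ((P.freqNat (S.q + 1) : ℝ) *
            Real.sqrt (rhoQ P S t / etaMass P S 𝒟.cut.η t) * (4 * ‖transposeCL‖ * CV))) :=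
          mul_le_mul_of_nonneg_left ((curlCLM.le_opNorm _).trans (mul_le_mul_of_nonneg_left hfast hKc))
            (inv_nonneg.2 hn0.le)
      _ = 4 * ‖curlCLM‖ * ‖transposeCL‖ * CV * Real.sqrt (rhoQ P S t / etaMass P S 𝒟.cut.η t) := by
          field_simp
      _ ≤ B := by rw [hBdef]; gcongr

/-- **Sup bound on the corrector** (Cor. 5.8 (5.30) in crude form): with `w_c = n⁻¹∑ᵢ BDSV.curl[slowᵢ]`
(`BDSV.correctorPart_proj`), at most one active cut-off, and the bound on the slow part
(`BDSV.norm_slowDeriv_le` with `‖DR̃‖ ≤ 9‖T‖ℓ⁻¹`, `‖D²Φ‖ ≤ ℓ⁻¹`, `‖Dη‖ ≤ C_η⁺ ≤ C_η⁺ℓ⁻¹`):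
`‖w_c(x,t)‖ ≤ 2π‖BDSV.curl‖‖T‖C_V(18‖T‖ + 1 + 2C_η⁺)(δ_{q+1}/c₀)^{1/2} ℓ⁻¹ λ_{q+1}⁻¹` (`n⁻¹ = 2π/λ_{q+1}`).
[cite: BuckmasterEtAl2018, Cor. 5.8 (5.30)] -/
theorem PerturbationData.correctorPart_sup_le (H : CoreHypotheses P S Nbar Cin C₀)
    (𝒟 : PerturbationData P S c₀ Cη) (𝔚 : MikadoDatum mikadoRadius) (hc₀ : 0 < c₀) (hCin : 0 ≤ Cin)
    (ha : 1 ≤ P.a) (hb : 1 ≤ P.b) (hβ : 0 ≤ P.β) (hα : 0 ≤ P.α) (hNbar : 1 ≤ Nbar)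
    (h4 : 4 * amp P.β P.a P.b (S.q + 2) ≤ amp P.β P.a P.b (S.q + 1) * freq P.a P.b S.q ^ (-P.α))
    (hdef : Real.exp (4 * (Cin * mollScale P.β P.α P.a P.b S.q ^ (2 * P.α))) - 1 ≤ 1 / 300)
    (hstr : 800 * (1 + ‖ofColsCL‖) * Cin *
      (freq P.a P.b S.q ^ P.α * mollScale P.β P.α P.a P.b S.q ^ P.α) ≤ 1)
    {CV : ℝ} (hCV0 : 0 ≤ CV)
    (hCV : ∀ m ≤ 1, ∀ T ∈ mikadoBallCL, ∀ ξ : ℝ³, ‖iteratedFDeriv ℝ m (mikadoLiftCL 𝔚.V) (T, ξ)‖ ≤ CV)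
    {t : ℝ} (ht : t ∈ Icc 0 S.T) (x : 𝕋³) :
    ‖correctorPart P S 𝔚 𝒟.cut.η 𝒟.D t x‖ ≤
      2 * Real.pi * ‖curlCLM‖ * ‖transposeCL‖ * CV * (18 * ‖transposeCL‖ + 1 + 2 * max (Cη 0 1) 0) *
        (Real.sqrt (amp P.β P.a P.b (S.q + 1) / c₀) * (mollScale P.β P.α P.a P.b S.q)⁻¹ *
          (freq P.a P.b (S.q + 1))⁻¹) := by
  obtain ⟨y, rfl⟩ := proj_surjective x
  set ℓ := mollScale P.β P.α P.a P.b S.q with hℓdef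
  have hℓ : 0 < ℓ := mollScale_pos ha _
  have hℓ1 : 1 ≤ ℓ⁻¹ := one_le_mollScale_inv ha hb hβ hα S.q
  set θ : ℝ := ‖transposeCL‖ with hθdef
  have hθ : 0 ≤ θ := norm_nonneg transposeCL
  set Kc : ℝ := ‖curlCLM‖ with hKcdef
  have hKc : 0 ≤ Kc := norm_nonneg curlCLM
  set Cηp : ℝ := max (Cη 0 1) 0 with hCηpdef
  have hCηp : 0 ≤ Cηp := le_max_right _ _
  set σ' : ℝ := Real.sqrt (amp P.β P.a P.b (S.q + 1) / c₀) with hσ'def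
  have hσ'0 : 0 ≤ σ' := Real.sqrt_nonneg _
  set B : ℝ := Kc * (θ * CV * (18 * θ + 1 + 2 * Cηp) * (σ' * ℓ⁻¹)) with hBdef
  have hB0 : 0 ≤ B := by positivity
  have hn0 : (0 : ℝ) < P.freqNat (S.q + 1) := Nat.cast_pos.2 (P.freqNat_pos ha _)
  have hηs : ∀ j, IsSmooth (𝒟.cut.η j t) := fun j => (𝒟.cut.smooth j).isSmooth_slice ht
  have hRs : IsSmooth (S.Rbar t) := H.eulerReynolds.smooth_stress.isSmooth_slice ht
  have hDs : ∀ j, IsSmooth (𝒟.D j t) := fun j => (𝒟.flow j).smooth.isSmooth_slice ht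
  have hsymm := H.eulerReynolds.symm t ht
  have hσ0 : 0 ≤ Real.sqrt (rhoQ P S t / etaMass P S 𝒟.cut.η t) := Real.sqrt_nonneg _
  have hσ := 𝒟.sqrt_rhoQ_div_etaMass_le H hc₀ ha ht
  have hball : ∀ j, 𝒟.cut.η j t (proj y) ≠ 0 →
      tildeR P S 𝒟.cut.η 𝒟.D j t (proj y) ∈ Metric.closedBall (1 : 𝕄) mikadoRadius :=
    fun j hne => (𝒟.active_bounds H hCin ha hNbar h4 hdef hstr ht hne).2.2.1
  have hzero : ∀ j, 𝒟.cut.η j t (proj y) = 0 → curlCLM (slowPart P S 𝔚 𝒟.cut.η 𝒟.D j t y) = 0 := by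
    intro j hj0
    have hy : lift (𝒟.cut.η j t) y = 0 := by rw [lift_apply]; exact hj0
    rw [slowPart, slowDeriv_eq_zero hy (fderiv_lift_eq_zero_of_nonneg (𝒟.cut.nonneg j t) hy), map_zero]
  have hsum : ‖∑ j ∈ Finset.range (cutoffCount S.T (P.τ S.q)), curlCLM (slowPart P S 𝔚 𝒟.cut.η 𝒟.D j t y)‖ ≤ B := by
    refine 𝒟.cut.norm_sum_le t (proj y) hB0 hzero (fun j => ?_) _
    by_cases hne : 𝒟.cut.η j t (proj y) = 0
    · rw [hzero j hne, norm_zero]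
      exact hB0
    · obtain ⟨hd1, hd2, -, hK, ht1⟩ := 𝒟.active_bounds H hCin ha hNbar h4 hdef hstr ht hne
      have he := 𝒟.norm_fderiv_lift_eta_le j ht y
      have hV0 : ‖mikadoLiftCL 𝔚.V (stressCL (etaMass P S 𝒟.cut.η t / rhoQ P S t) (S.Rbar t)
          (𝒟.D j t) y, (P.freqNat (S.q + 1) : ℝ) • (y + lift (𝒟.D j t) y))‖ ≤ CV := by
        have h := hCV 0 zero_le_one _ hK ((P.freqNat (S.q + 1) : ℝ) • (y + lift (𝒟.D j t) y))
        rwa [norm_iteratedFDeriv_zero] at h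
      have hV1 : ‖fderiv ℝ (mikadoLiftCL 𝔚.V) (stressCL (etaMass P S 𝒟.cut.η t / rhoQ P S t) (S.Rbar t)
          (𝒟.D j t) y, (P.freqNat (S.q + 1) : ℝ) • (y + lift (𝒟.D j t) y))‖ ≤ CV := by
        have h := hCV 1 le_rfl _ hK ((P.freqNat (S.q + 1) : ℝ) • (y + lift (𝒟.D j t) y))
        rwa [norm_iteratedFDeriv_one_eq_norm_fderiv] at h
      have hslow := norm_slowDeriv_le (V := 𝔚.V) (c := etaMass P S 𝒟.cut.η t / rhoQ P S t)
        (n := (P.freqNat (S.q + 1) : ℝ)) hσ0 he.1 he.2 hd1 hd2 ht1 hV0 hV1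
      have hCV0' : 0 ≤ θ * CV := mul_nonneg hθ hCV0
      calc ‖curlCLM (slowPart P S 𝔚 𝒟.cut.η 𝒟.D j t y)‖
          ≤ Kc * ‖slowPart P S 𝔚 𝒟.cut.η 𝒟.D j t y‖ := curlCLM.le_opNorm _
        _ ≤ Kc * (Real.sqrt (rhoQ P S t / etaMass P S 𝒟.cut.η t) * θ * CV *
              (2 * (9 * θ * ℓ⁻¹) + ℓ⁻¹ + 2 * Cηp)) := mul_le_mul_of_nonneg_left hslow hKc
        _ ≤ Kc * (σ' * θ * CV * (2 * (9 * θ * ℓ⁻¹) + ℓ⁻¹ + 2 * (Cηp * ℓ⁻¹))) := by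
            refine mul_le_mul_of_nonneg_left ?_ hKc
            refine mul_le_mul (by gcongr) ?_ (by positivity) (by positivity)
            nlinarith [mul_nonneg hCηp (sub_nonneg.2 hℓ1)]
        _ = B := by rw [hBdef]; ring
  have hninv : ((P.freqNat (S.q + 1) : ℝ))⁻¹ = 2 * Real.pi * (freq P.a P.b (S.q + 1))⁻¹ := by
    rw [P.freq_eq (by linarith) (S.q + 1)]
    field_simp
  rw [correctorPart_proj hηs hRs hDs hsymm (P.freqNat_pos ha _).ne' hball, norm_smul, norm_inv,
    Real.norm_natCast, hninv]
  calc 2 * Real.pi * (freq P.a P.b (S.q + 1))⁻¹ *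
        ‖∑ j ∈ Finset.range (cutoffCount S.T (P.τ S.q)), curlCLM (slowPart P S 𝔚 𝒟.cut.η 𝒟.D j t y)‖
      ≤ 2 * Real.pi * (freq P.a P.b (S.q + 1))⁻¹ * B :=
        mul_le_mul_of_nonneg_left hsum (mul_nonneg (by positivity) (inv_nonneg.2 (freq_pos ha _).le))
    _ = _ := by rw [hBdef]; ring

end SupBounds

section Discharge

variable {P : Params} {S : Setting} {Nbar : ℕ} {Cin C₀ c₀ : ℝ} {Cη : ℕ → ℕ → ℝ}

/-- **The corrector terms of the energy at fixed parameters** (the second estimate of the proof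
of Prop. 6.2): with `‖w_o‖₀ ≤ C_o δ_{q+1}^{1/2}` and `‖w_c‖₀ ≤ C_c δ_{q+1}^{1/2}ℓ⁻¹λ_{q+1}⁻¹`,
`|∫ 2w_o·w_c + |w_c|²| = |∫⟪2w_o + w_c, w_c⟫| ≤ (2C_o C_c + C_c²) δ_{q+1} ℓ⁻¹ λ_{q+1}⁻¹`, using
(6.6) `ℓλ_{q+1} ≥ 1`. Here `C_o = 4KθC_V/√c₀`, `C_c = 2πKθC_V(18θ + 1 + 2C_η⁺)/√c₀`
(`K = ‖curlCLM‖`, `θ = ‖transposeCL‖`). [cite: BuckmasterEtAl2018, Prop. 6.2 (proof, estimate of ∫ 2w_o·w_c + |w_c|²)] -/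
theorem PerturbationData.abs_integral_corrector_le (H : CoreHypotheses P S Nbar Cin C₀)
    (𝒟 : PerturbationData P S c₀ Cη) (𝔚 : MikadoDatum mikadoRadius) (hc₀ : 0 < c₀) (hCin : 0 ≤ Cin)
    (ha : 1 ≤ P.a) (hb : 1 ≤ P.b) (hβ : 0 ≤ P.β) (hα : 0 ≤ P.α) (hNbar : 1 ≤ Nbar)
    (h4 : 4 * amp P.β P.a P.b (S.q + 2) ≤ amp P.β P.a P.b (S.q + 1) * freq P.a P.b S.q ^ (-P.α))
    (hdef : Real.exp (4 * (Cin * mollScale P.β P.α P.a P.b S.q ^ (2 * P.α))) - 1 ≤ 1 / 300)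
    (hstr : 800 * (1 + ‖ofColsCL‖) * Cin *
      (freq P.a P.b S.q ^ P.α * mollScale P.β P.α P.a P.b S.q ^ P.α) ≤ 1)
    (hℓf : 1 ≤ mollScale P.β P.α P.a P.b S.q * freq P.a P.b (S.q + 1))
    {CV : ℝ} (hCV0 : 0 ≤ CV)
    (hCV : ∀ m ≤ 1, ∀ T ∈ mikadoBallCL, ∀ ξ : ℝ³, ‖iteratedFDeriv ℝ m (mikadoLiftCL 𝔚.V) (T, ξ)‖ ≤ CV)
    {t : ℝ} (ht : t ∈ Icc 0 S.T) :
    |∫ x, (2 * ⟪principalPart P S 𝔚 𝒟.cut.η 𝒟.D t x, correctorPart P S 𝔚 𝒟.cut.η 𝒟.D t x⟫_ℝ +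
        ‖correctorPart P S 𝔚 𝒟.cut.η 𝒟.D t x‖ ^ 2)| ≤
      (2 * (4 * ‖curlCLM‖ * ‖transposeCL‖ * CV / Real.sqrt c₀) *
          (2 * Real.pi * ‖curlCLM‖ * ‖transposeCL‖ * CV * (18 * ‖transposeCL‖ + 1 + 2 * max (Cη 0 1) 0) /
            Real.sqrt c₀) +
        (2 * Real.pi * ‖curlCLM‖ * ‖transposeCL‖ * CV * (18 * ‖transposeCL‖ + 1 + 2 * max (Cη 0 1) 0) /
            Real.sqrt c₀) ^ 2) *
      (amp P.β P.a P.b (S.q + 1) * (mollScale P.β P.α P.a P.b S.q)⁻¹ * (freq P.a P.b (S.q + 1))⁻¹) := by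
  set Co : ℝ := 4 * ‖curlCLM‖ * ‖transposeCL‖ * CV / Real.sqrt c₀ with hCodef
  set Cc : ℝ := 2 * Real.pi * ‖curlCLM‖ * ‖transposeCL‖ * CV * (18 * ‖transposeCL‖ + 1 + 2 * max (Cη 0 1) 0) /
    Real.sqrt c₀ with hCcdef
  set ℓ := mollScale P.β P.α P.a P.b S.q with hℓdef
  set lam := freq P.a P.b (S.q + 1) with hlamdef
  set s := Real.sqrt (amp P.β P.a P.b (S.q + 1)) with hsdef
  have hℓ : 0 < ℓ := mollScale_pos ha _
  have hlam : 0 < lam := freq_pos ha _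
  have hsc : 0 < Real.sqrt c₀ := Real.sqrt_pos.2 hc₀
  have hKc : 0 ≤ ‖curlCLM‖ := norm_nonneg curlCLM
  have hθ : 0 ≤ ‖transposeCL‖ := norm_nonneg transposeCL
  have hCηp : 0 ≤ max (Cη 0 1) 0 := le_max_right _ _
  have hCo : 0 ≤ Co :=
    div_nonneg (mul_nonneg (mul_nonneg (mul_nonneg (by norm_num) hKc) hθ) hCV0) hsc.le
  have hCc : 0 ≤ Cc :=
    div_nonneg (mul_nonneg (mul_nonneg (mul_nonneg (mul_nonneg (by positivity) hKc) hθ) hCV0)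
      (by nlinarith)) hsc.le
  have hs0 : 0 ≤ s := Real.sqrt_nonneg _
  have hsq : Real.sqrt (amp P.β P.a P.b (S.q + 1) / c₀) = s / Real.sqrt c₀ := Real.sqrt_div (amp_pos ha _).le c₀
  -- the two sup bounds, in the form `C_o s`, `C_c s u`
  set u : ℝ := ℓ⁻¹ * lam⁻¹ with hudef
  have hu0 : 0 ≤ u := mul_nonneg (inv_nonneg.2 hℓ.le) (inv_nonneg.2 hlam.le)
  have hu1 : u ≤ 1 := by
    rw [hudef, ← mul_inv, inv_le_one_iff₀]
    exact Or.inr hℓf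
  have hwo : ∀ x, ‖principalPart P S 𝔚 𝒟.cut.η 𝒟.D t x‖ ≤ Co * s := fun x => by
    have h := 𝒟.principalPart_sup_le H 𝔚 hc₀ hCin ha hNbar h4 hdef hstr hCV0 hCV ht x
    rw [hsq] at h
    refine h.trans (le_of_eq ?_)
    rw [hCodef, div_eq_mul_inv, div_eq_mul_inv]
    ring
  have hwc : ∀ x, ‖correctorPart P S 𝔚 𝒟.cut.η 𝒟.D t x‖ ≤ Cc * (s * u) := fun x => by
    have h := 𝒟.correctorPart_sup_le H 𝔚 hc₀ hCin ha hb hβ hα hNbar h4 hdef hstr hCV0 hCV ht x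
    rw [hsq] at h
    refine h.trans (le_of_eq ?_)
    rw [hCcdef, hudef, div_eq_mul_inv, div_eq_mul_inv]
    ring
  have h2 : ∀ x, ‖(2 : ℝ) • principalPart P S 𝔚 𝒟.cut.η 𝒟.D t x + correctorPart P S 𝔚 𝒟.cut.η 𝒟.D t x‖ ≤
      2 * (Co * s) + Cc * (s * u) := fun x =>
    (norm_add_le _ _).trans (add_le_add
      (by rw [norm_smul, Real.norm_eq_abs, abs_two]; exact mul_le_mul_of_nonneg_left (hwo x) two_pos.le)
      (hwc x))
  have heq : (fun x => 2 * ⟪principalPart P S 𝔚 𝒟.cut.η 𝒟.D t x, correctorPart P S 𝔚 𝒟.cut.η 𝒟.D t x⟫_ℝ +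
      ‖correctorPart P S 𝔚 𝒟.cut.η 𝒟.D t x‖ ^ 2) = fun x =>
      ⟪(2 : ℝ) • principalPart P S 𝔚 𝒟.cut.η 𝒟.D t x + correctorPart P S 𝔚 𝒟.cut.η 𝒟.D t x,
        correctorPart P S 𝔚 𝒟.cut.η 𝒟.D t x⟫_ℝ := by
    funext x
    rw [inner_add_left, real_inner_smul_left, real_inner_self_eq_norm_sq]
  rw [heq]
  have hB0 : 0 ≤ 2 * (Co * s) + Cc * (s * u) :=
    add_nonneg (mul_nonneg two_pos.le (mul_nonneg hCo hs0)) (mul_nonneg hCc (mul_nonneg hs0 hu0))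
  refine (abs_integral_inner_le h2 hwc hB0).trans ?_
  have hs2 : s ^ 2 = amp P.β P.a P.b (S.q + 1) := by
    rw [hsdef, Real.sq_sqrt (amp_pos ha _).le]
  have hkey : (2 * (Co * s) + Cc * (s * u)) * (Cc * (s * u)) =
      2 * Co * Cc * (s ^ 2 * u) + Cc ^ 2 * (s ^ 2 * u) * u := by ring
  rw [hkey]
  have hP : 0 ≤ Cc ^ 2 * (s ^ 2 * u) := mul_nonneg (sq_nonneg _) (mul_nonneg (sq_nonneg _) hu0)
  calc 2 * Co * Cc * (s ^ 2 * u) + Cc ^ 2 * (s ^ 2 * u) * u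
      ≤ 2 * Co * Cc * (s ^ 2 * u) + Cc ^ 2 * (s ^ 2 * u) * 1 :=
        add_le_add le_rfl (mul_le_mul_of_nonneg_left hu1 hP)
    _ = (2 * Co * Cc + Cc ^ 2) * (amp P.β P.a P.b (S.q + 1) * ℓ⁻¹ * lam⁻¹) := by
        rw [hs2, hudef]; ring

/-- **Discharge of G₂ `BDSV.energy_correctorTerm`** (BDSV, proof of Prop. 6.2, second estimate):
along the common prefix, `|∫_{T³} 2w_o·w_c + |w_c|² dx| ≤ C δ_{q+1} ℓ⁻¹ λ_{q+1}⁻¹` for every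
`t ∈ [0,T]`, with `α₀ = min(βb(b-1), (b-1)(1-β)/2)`, `N̄ = 1`, the constant of
`BDSV.PerturbationData.abs_integral_corrector_le` (with `C_in⁺ = max(C_in, 0)` and `C_V` the bound of
the Mikado potential and its first derivative on the Mikado ball), and `a₀` the largest of the
thresholds of `4δ_{q+2} ≤ δ_{q+1}λ_q^{-α}`, `exp(4C_in⁺ℓ^{2α}) - 1 ≤ 1/300`,
`800(1 + ‖ofCols‖)C_in⁺(λ_qℓ)^α ≤ 1` and `ℓλ_{q+1} ≥ 1`.
[cite: BuckmasterEtAl2018, Prop. 6.2 (proof, estimate of ∫ 2w_o·w_c + |w_c|²)] -/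
theorem energy_correctorTerm_holds : energy_correctorTerm := by
  intro 𝔚 c₀ hc₀ Cη β hβ hβ' b hb hb'
  have hb0 : (0 : ℝ) < b := by linarith
  have hb1 : 0 < b - 1 := by linarith
  have h1β : 0 < 1 - β := by linarith
  refine ⟨min (β * b * (b - 1)) ((b - 1) * (1 - β) / 2),
    lt_min (mul_pos (mul_pos hβ hb0) hb1) (div_pos (mul_pos hb1 h1β) two_pos),
    fun α hα hαlt => ⟨1, fun Cin C₀ => ?_⟩⟩
  have hα₁ : α < β * b * (b - 1) := lt_of_lt_of_le hαlt (min_le_left _ _)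
  have hα₂ : α < (b - 1) * (1 - β) / 2 := lt_of_lt_of_le hαlt (min_le_right _ _)
  have hαb : α < 2 * β * b * (b - 1) := by nlinarith [mul_pos (mul_pos hβ hb0) hb1]
  have hαb' : 3 * α / 2 < (b - 1) * (1 - β) := by nlinarith [mul_pos hb1 h1β]
  have hCp0 : 0 ≤ max Cin 0 := le_max_right _ _
  obtain ⟨a₁, ha₁, hpar₁⟩ := exists_threshold_four_amp hb hαb
  obtain ⟨a₂, ha₂, hpar₂⟩ := exists_threshold_deformation hβ.le hb.le hα hCp0 (b := b)
  obtain ⟨a₃, ha₃, hpar₃⟩ := exists_threshold_freq_mul_mollScale_rpow_le hβ.le hb.le hα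
    (800 * (1 + ‖ofColsCL‖) * max Cin 0) one_pos
  obtain ⟨a₄, ha₄, hpar₄⟩ := exists_threshold_mollScale_freq_succ hb.le hαb' 1
  obtain ⟨CV, hCV0, hCV⟩ := exists_forall_le_norm_iteratedFDeriv_mikadoLiftCL_le
    𝔚.contDiff_mikadoLift_V isCompact_mikadoBallCL 1
  refine ⟨2 * (4 * ‖curlCLM‖ * ‖transposeCL‖ * CV / Real.sqrt c₀) *
      (2 * Real.pi * ‖curlCLM‖ * ‖transposeCL‖ * CV * (18 * ‖transposeCL‖ + 1 + 2 * max (Cη 0 1) 0) /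
        Real.sqrt c₀) +
      (2 * Real.pi * ‖curlCLM‖ * ‖transposeCL‖ * CV * (18 * ‖transposeCL‖ + 1 + 2 * max (Cη 0 1) 0) /
        Real.sqrt c₀) ^ 2,
    max (max a₁ a₂) (max a₃ a₄), lt_max_of_lt_left (lt_max_of_lt_left ha₁), fun a ha S H 𝒟 t ht => ?_⟩
  have ha₁' : a₁ ≤ a := le_trans (le_max_left _ _) (le_trans (le_max_left _ _) ha)
  have ha₂' : a₂ ≤ a := le_trans (le_max_right _ _) (le_trans (le_max_left _ _) ha)
  have ha₃' : a₃ ≤ a := le_trans (le_max_left _ _) (le_trans (le_max_right _ _) ha)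
  have ha₄' : a₄ ≤ a := le_trans (le_max_right _ _) (le_trans (le_max_right _ _) ha)
  have ha1 : (1 : ℝ) ≤ a := ha₁.le.trans ha₁'
  exact 𝒟.abs_integral_corrector_le (H.mono_const ha1 (le_max_left _ _)) 𝔚 hc₀ hCp0 ha1 hb.le hβ.le
    hα.le le_rfl (hpar₁ a ha₁' S.q) (hpar₂ a ha₂' S.q) (hpar₃ a ha₃' S.q) (hpar₄ a ha₄' S.q) hCV0 hCV ht

end Discharge

end DeRosa

/-! ## Port of `OnsagerBDSVCorrectorBoundsProofs` -/

namespace DeRosa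

open BDSV

open FunctionSpaces FunctionSpaces.Torus

-- nested spaces of continuous linear maps over `EuclideanSpace ℝ (Fin 3)` need deeper
-- instance synthesis during unification (operator norms on `(ℝ³ →L 𝕃) →L (ℝ³ →L 𝕃)` etc.)
set_option maxSynthPendingDepth 3

/-- The flat three-torus `T³ = (ℝ/ℤ)³`, local notation. -/
local notation "𝕋³" => UnitAddTorus (Fin 3)

/-- Euclidean `ℝ³`, local notation. -/
local notation "ℝ³" => EuclideanSpace ℝ (Fin 3)

/-- Real `3 × 3` matrices, local notation. -/
local notation "𝕄" => Matrix (Fin 3) (Fin 3) ℝ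

/-- Continuous linear endomorphisms of `ℝ³`, local notation. -/
local notation "𝕃" => (EuclideanSpace ℝ (Fin 3) →L[ℝ] EuclideanSpace ℝ (Fin 3))

section EnvelopeHelpers

variable {E F : Type*} [NormedAddCommGroup E] [NormedSpace ℝ E] [NormedAddCommGroup F]
  [NormedSpace ℝ F]

end EnvelopeHelpers

section SlowEnvelope

variable {V : 𝕄 → 𝕋³ → ℝ³} {σ c n : ℝ} {ηsl : 𝕋³ → ℝ} {Rsl : 𝕋³ → Fin 3 → ℝ³} {Dsl : 𝕋³ → ℝ³}

end SlowEnvelope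

section SlowSmooth

variable {V : 𝕄 → 𝕋³ → ℝ³} {σ c n : ℝ} {ηsl : 𝕋³ → ℝ} {Rsl : 𝕋³ → Fin 3 → ℝ³} {Dsl : 𝕋³ → ℝ³}

end SlowSmooth

section Torus

variable {P : Params} {S : Setting} {𝔚 : MikadoDatum mikadoRadius} {η : ℕ → ℝ → 𝕋³ → ℝ}
  {D : ℕ → ℝ → 𝕋³ → ℝ³} {t : ℝ}

end Torus

section Inputs

variable {P : Params} {S : Setting} {Nbar : ℕ} {Cin C₀ c₀ : ℝ} {Cη : ℕ → ℕ → ℝ}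

/-- **The normalised stress derivatives**: with `c = ∑∫η_j²/ρ_q`, `o = ‖ofColsCL‖`, under
`4δ_{q+2} ≤ δ_{q+1}λ_q^{-α}` and the smallness `8 o C_in λ_q^α ℓ^α ≤ 1`,
`|c| o ‖Dᵏ(lift R̊̄_q(t))‖ ≤ ℓ^{-k}` for `k = 0, 1, 2` (`k ≤ N̄`) — from (2.20) `‖R̊̄_q‖_{k+α} ≤ C_in δ_{q+1} ℓ^{-k+α}`
and `c ≤ 8λ_q^α/δ_{q+1}` (the "crude estimate" `‖R/ρ‖_N ≲ 1 + ℓ^{-N+α} λ_q^α ≲ ℓ^{-N}` of Prop. 5.7).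
[cite: BuckmasterEtAl2018, Prop. 5.7 (proof, (5.32)–(5.33))] -/
theorem PerturbationData.abs_c_mul_norm_iteratedFDeriv_lift_Rbar_le (H : CoreHypotheses P S Nbar Cin C₀)
    (𝒟 : PerturbationData P S c₀ Cη) (hCin : 0 ≤ Cin) (ha : 1 ≤ P.a)
    (h4 : 4 * amp P.β P.a P.b (S.q + 2) ≤ amp P.β P.a P.b (S.q + 1) * freq P.a P.b S.q ^ (-P.α))
    (hstr : 8 * ‖ofColsCL‖ * Cin * (freq P.a P.b S.q ^ P.α * mollScale P.β P.α P.a P.b S.q ^ P.α) ≤ 1)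
    {k : ℕ} (hk : k ≤ Nbar) {t : ℝ} (ht : t ∈ Icc 0 S.T) (y : ℝ³) :
    |etaMass P S 𝒟.cut.η t / rhoQ P S t| * ‖ofColsCL‖ * ‖iteratedFDeriv ℝ k (lift (S.Rbar t)) y‖ ≤
      (mollScale P.β P.α P.a P.b S.q)⁻¹ ^ k := by
  obtain ⟨hc0, hc⟩ := 𝒟.etaMass_div_rhoQ_le H ha h4 ht
  have hℓ := mollScale_pos (β := P.β) (α := P.α) (b := P.b) ha S.q
  have hδ : 0 < amp P.β P.a P.b (S.q + 1) := amp_pos ha _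
  have hr := H.norm_iteratedFDeriv_lift_Rbar_le hCin ha hk le_rfl ht y
  have hsplit : mollScale P.β P.α P.a P.b S.q ^ (-(k : ℝ) + P.α) =
      (mollScale P.β P.α P.a P.b S.q)⁻¹ ^ k * mollScale P.β P.α P.a P.b S.q ^ P.α := by
    rw [Real.rpow_add hℓ, Real.rpow_neg hℓ.le, Real.rpow_natCast, inv_pow]
  rw [abs_of_nonneg hc0]
  calc etaMass P S 𝒟.cut.η t / rhoQ P S t * ‖ofColsCL‖ * ‖iteratedFDeriv ℝ k (lift (S.Rbar t)) y‖
      ≤ (8 * freq P.a P.b S.q ^ P.α / amp P.β P.a P.b (S.q + 1)) * ‖ofColsCL‖ *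
          (Cin * (amp P.β P.a P.b (S.q + 1) * mollScale P.β P.α P.a P.b S.q ^ (-(k : ℝ) + P.α))) :=
        mul_le_mul (mul_le_mul_of_nonneg_right hc (norm_nonneg _)) hr (norm_nonneg _)
          (mul_nonneg (div_nonneg (mul_nonneg (by norm_num) (Real.rpow_nonneg (freq_pos ha _).le _)) hδ.le)
            (norm_nonneg _))
    _ = 8 * ‖ofColsCL‖ * Cin * (freq P.a P.b S.q ^ P.α * mollScale P.β P.α P.a P.b S.q ^ P.α) *
          (mollScale P.β P.α P.a P.b S.q)⁻¹ ^ k := by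
        rw [hsplit]; field_simp
    _ ≤ 1 * (mollScale P.β P.α P.a P.b S.q)⁻¹ ^ k :=
        mul_le_mul_of_nonneg_right hstr (pow_nonneg (inv_nonneg.2 hℓ.le) _)
    _ = _ := one_mul _

/-- **Flow bounds on the support of a cut-off** (App. B (B.4)–(B.5) for the backward flow `Φᵢ`,
localised by property (iv): `|t - tᵢ*| ≤ 4τ_q/3`, and `τ_q δ_q^{1/2}λ_q C_in = C_in ℓ^{2α} =: u`): if
`u ≤ 1/2400` then wherever `ηᵢ(t,·) ≠ 0` somewhere,
`‖D(lift Dᵢ(t))‖ ≤ 1/600`, `‖D²(lift Dᵢ(t))‖ ≤ ℓ⁻¹`, `‖D³(lift Dᵢ(t))‖ ≤ 2ℓ⁻²` (the content of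
Lemma 5.4 (5.14) and Prop. 5.7 (5.23) at orders `≤ 2`, with `N̄ ≥ 2`).
[cite: BuckmasterEtAl2018, Lemma 5.4 (5.14) and Prop. 5.7 (arXiv (5.23))] -/
theorem PerturbationData.norm_iteratedFDeriv_lift_D_le (H : CoreHypotheses P S Nbar Cin C₀)
    (𝒟 : PerturbationData P S c₀ Cη) (hNbar : 2 ≤ Nbar) (hCin : 0 ≤ Cin) (ha : 1 ≤ P.a) (hb : 1 ≤ P.b)
    (hβ : 0 ≤ P.β) (hα : 0 ≤ P.α)
    (hu : Cin * mollScale P.β P.α P.a P.b S.q ^ (2 * P.α) ≤ 1 / 2400)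
    {i : ℕ} {t : ℝ} (ht : t ∈ Icc 0 S.T) {x' : 𝕋³} (hη : 𝒟.cut.η i t x' ≠ 0) (y : ℝ³) :
    ‖iteratedFDeriv ℝ 1 (lift (𝒟.D i t)) y‖ ≤ 1 / 600 ∧
      ‖iteratedFDeriv ℝ 2 (lift (𝒟.D i t)) y‖ ≤ (mollScale P.β P.α P.a P.b S.q)⁻¹ ∧
      ‖iteratedFDeriv ℝ 3 (lift (𝒟.D i t)) y‖ ≤ 2 * (mollScale P.β P.α P.a P.b S.q)⁻¹ ^ 2 := by
  set ℓ := mollScale P.β P.α P.a P.b S.q with hℓdef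
  set Λ := Cin * (Real.sqrt (amp P.β P.a P.b S.q) * freq P.a P.b S.q) with hΛdef
  set u := Cin * ℓ ^ (2 * P.α) with hudef
  have hℓ : 0 < ℓ := mollScale_pos ha S.q
  have hℓ1 : ℓ ≤ 1 := mollScale_le_one_of_params ha hb hβ hα S.q
  have hτ : 0 < P.τ S.q := glueScale_pos ha S.q
  have hΛ0 : 0 ≤ Λ := mul_nonneg hCin (mul_nonneg (Real.sqrt_nonneg _) (freq_pos ha _).le)
  have hu0 : 0 ≤ u := mul_nonneg hCin (Real.rpow_nonneg hℓ.le _)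
  have hΛτ : Λ * P.τ S.q = u := velocityBound_mul_tau ha S.q
  -- bounds on the velocity derivatives
  have hV : ∀ N : ℕ, N ≤ Nbar → ∀ s ∈ Icc 0 S.T, ∀ z : ℝ³,
      ‖iteratedFDeriv ℝ (N + 1) (lift (S.vbar s)) z‖ ≤ Λ * ℓ⁻¹ ^ N := by
    intro N hN s hs z
    have h := H.norm_iteratedFDeriv_lift_vbar_le hCin ha hN le_rfl hs z
    rwa [Real.rpow_neg hℓ.le, Real.rpow_natCast, ← inv_pow, ← mul_assoc, ← hΛdef] at h
  have hb₁ : ∀ s ∈ Icc 0 S.T, ∀ z : ℝ³, ‖iteratedFDeriv ℝ 1 (lift (S.vbar s)) z‖ ≤ Λ := fun s hs z => by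
    simpa using hV 0 (Nat.zero_le _) s hs z
  have hb₂ : ∀ s ∈ Icc 0 S.T, ∀ z : ℝ³, ‖iteratedFDeriv ℝ 2 (lift (S.vbar s)) z‖ ≤ Λ * ℓ⁻¹ := fun s hs z => by
    simpa using hV 1 (le_trans (by norm_num) hNbar) s hs z
  have hb₃ : ∀ s ∈ Icc 0 S.T, ∀ z : ℝ³, ‖iteratedFDeriv ℝ 3 (lift (S.vbar s)) z‖ ≤ Λ * ℓ⁻¹ ^ 2 :=
    fun s hs z => hV 2 hNbar s hs z
  -- time localisation
  have hanchor : min ((i : ℝ) * P.τ S.q) S.T ∈ Icc 0 S.T :=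
    ⟨le_min (mul_nonneg i.cast_nonneg hτ.le) H.pos_T.le, min_le_right _ _⟩
  have hdt : |t - min ((i : ℝ) * P.τ S.q) S.T| ≤ 4 * P.τ S.q / 3 := CutoffFamily.abs_sub_anchor_le hτ 𝒟.cut ht hη
  set d := |t - min ((i : ℝ) * P.τ S.q) S.T| with hddef
  have hd0 : 0 ≤ d := abs_nonneg _
  have hdΛ : d * Λ ≤ 4 * u / 3 := by
    calc d * Λ ≤ (4 * P.τ S.q / 3) * Λ := mul_le_mul_of_nonneg_right hdt hΛ0
      _ = 4 * (Λ * P.τ S.q) / 3 := by ring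
      _ = 4 * u / 3 := by rw [hΛτ]
  have hdΛ1 : d * Λ ≤ 1 := hdΛ.trans (by linarith)
  obtain ⟨h1, h2, h3⟩ := FlowDisplacement.norm_iteratedFDeriv_lift_le H.pos_T H.eulerReynolds.smooth_velocity
    hanchor (𝒟.flow i) hΛ0 (mul_nonneg hΛ0 (inv_nonneg.2 hℓ.le)) (mul_nonneg hΛ0 (pow_nonneg (inv_nonneg.2 hℓ.le) 2))
    hb₁ hb₂ hb₃ ht hdΛ1 y
  have hℓi : 0 ≤ ℓ⁻¹ := inv_nonneg.2 hℓ.le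
  have hℓi1 : 1 ≤ ℓ⁻¹ := one_le_inv_iff₀.2 ⟨hℓ, hℓ1⟩
  refine ⟨?_, ?_, ?_⟩
  · calc ‖iteratedFDeriv ℝ 1 (lift (𝒟.D i t)) y‖ ≤ 3 * Λ * d := h1
      _ = 3 * (d * Λ) := by ring
      _ ≤ 3 * (4 * u / 3) := by nlinarith
      _ ≤ 1 / 600 := by nlinarith
  · calc ‖iteratedFDeriv ℝ 2 (lift (𝒟.D i t)) y‖ ≤ 32 * (Λ * ℓ⁻¹) * d := h2
      _ = 32 * (d * Λ) * ℓ⁻¹ := by ring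
      _ ≤ 32 * (4 * u / 3) * ℓ⁻¹ := by gcongr
      _ ≤ ℓ⁻¹ := by nlinarith
  · calc ‖iteratedFDeriv ℝ 3 (lift (𝒟.D i t)) y‖ ≤ 2100 * (Λ * ℓ⁻¹ ^ 2 + (Λ * ℓ⁻¹) ^ 2 * d) * d := h3
      _ = 2100 * ((d * Λ) * ℓ⁻¹ ^ 2 + (d * Λ) * (d * Λ) * ℓ⁻¹ ^ 2) := by ring
      _ ≤ 2100 * ((4 * u / 3) * ℓ⁻¹ ^ 2 + (4 * u / 3) * (4 * u / 3) * ℓ⁻¹ ^ 2) := by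
          gcongr
      _ = 2100 * (4 * u / 3 + (4 * u / 3) * (4 * u / 3)) * ℓ⁻¹ ^ 2 := by ring
      _ ≤ 2 * ℓ⁻¹ ^ 2 := by
          refine mul_le_mul_of_nonneg_right ?_ (pow_nonneg hℓi 2)
          have hw : 4 * u / 3 ≤ 1 / 1800 := by linarith
          have hw0 : 0 ≤ 4 * u / 3 := by positivity
          have hww : (4 * u / 3) * (4 * u / 3) ≤ (1 / 1800) * (4 * u / 3) := mul_le_mul_of_nonneg_right hw hw0
          linarith

end Inputs

section SlowPartEnvelope

variable {P : Params} {S : Setting} {Nbar : ℕ} {Cin C₀ c₀ : ℝ} {Cη : ℕ → ℕ → ℝ}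

/-- **The slow part of the construction has a two-scale envelope** (the quantitative core of
Cor. 5.8 (5.30)): under the standing hypotheses with `N̄ ≥ 2`, `C_in ≥ 0`, `c₀ > 0`, and the parameter
inequalities `4δ_{q+2} ≤ δ_{q+1}λ_q^{-α}`, `C_in ℓ^{2α} ≤ 1/2400`, `8‖ofCols‖C_in λ_q^αℓ^α ≤ 1` and (6.6)
`ℓ⁻¹λ_{q+1}⁻¹ ≤ 1` (all valid for `a` large), if `‖DᵐV‖ ≤ C_V` (`m ≤ 2`) on the ball of radius
`BDSV.(3 + 4 * ‖transposeCL‖)` about `Id`, then for `t ∈ [0,T]` and every `i` with `ηᵢ(t,·) ≢ 0`,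
`slowPartᵢ(t)` has the order-one envelope `(corrAmp · δ_{q+1}^{1/2} ℓ⁻¹, 2 corrFreq · n_{q+1})`:
`‖slowPartᵢ‖ ≲ δ_{q+1}^{1/2}ℓ⁻¹` and `‖D slowPartᵢ‖ ≲ δ_{q+1}^{1/2}ℓ⁻¹λ_{q+1}`.
[cite: BuckmasterEtAl2018, Cor. 5.8 (5.30) with Prop. 5.7 (5.23)–(5.26) and Lemma 5.4] -/
theorem PerturbationData.hasEnvelope_slowPart (H : CoreHypotheses P S Nbar Cin C₀)
    (𝒟 : PerturbationData P S c₀ Cη) (𝔚 : MikadoDatum mikadoRadius) (hNbar : 2 ≤ Nbar) (hc₀ : 0 < c₀)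
    (hCin : 0 ≤ Cin) (ha : 1 ≤ P.a) (hb : 1 ≤ P.b) (hβ : 0 ≤ P.β) (hα : 0 ≤ P.α)
    (h4 : 4 * amp P.β P.a P.b (S.q + 2) ≤ amp P.β P.a P.b (S.q + 1) * freq P.a P.b S.q ^ (-P.α))
    (hu : Cin * mollScale P.β P.α P.a P.b S.q ^ (2 * P.α) ≤ 1 / 2400)
    (hstr : 8 * ‖ofColsCL‖ * Cin * (freq P.a P.b S.q ^ P.α * mollScale P.β P.α P.a P.b S.q ^ P.α) ≤ 1)
    (h66 : (mollScale P.β P.α P.a P.b S.q)⁻¹ * (freq P.a P.b (S.q + 1))⁻¹ ≤ 1)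
    {CV : ℝ} (hCV0 : 0 ≤ CV)
    (hCV : ∀ m ≤ 2, ∀ L ∈ Metric.closedBall (1 : 𝕃) (3 + 4 * ‖transposeCL‖), ∀ ξ : ℝ³,
      ‖iteratedFDeriv ℝ m (mikadoLiftCL 𝔚.V) (L, ξ)‖ ≤ CV)
    {i : ℕ} {t : ℝ} (ht : t ∈ Icc 0 S.T) {x' : 𝕋³} (hη : 𝒟.cut.η i t x' ≠ 0) :
    HasEnvelope (slowPart P S 𝔚 𝒟.cut.η 𝒟.D i t) 1
      ((‖transposeCL‖ * CV * (16 * (32 * ‖transposeCL‖) + 4 * 2 + 8 * max (Cη 0 2) 0) / Real.sqrt c₀) *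
        Real.sqrt (amp P.β P.a P.b (S.q + 1)) * (mollScale P.β P.α P.a P.b S.q)⁻¹)
      (2 * ((2 * Real.pi * (32 * ‖transposeCL‖ + 3) + max (Cη 0 2) 0 + 1) * P.freqNat (S.q + 1))) := by
  -- names
  set ℓ := mollScale P.β P.α P.a P.b S.q with hℓdef
  set θ : ℝ := ‖transposeCL‖ with hθdef
  set Kη : ℝ := max (Cη 0 2) 0 with hKηdef
  set σ : ℝ := Real.sqrt (rhoQ P S t / etaMass P S 𝒟.cut.η t) with hσdef
  set c : ℝ := etaMass P S 𝒟.cut.η t / rhoQ P S t with hcdef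
  set n : ℝ := (P.freqNat (S.q + 1) : ℝ) with hndef
  set μ : ℝ := (2 * Real.pi * (32 * ‖transposeCL‖ + 3) + max (Cη 0 2) 0 + 1) * n with hμdef
  have hθ : 0 ≤ θ := norm_nonneg _
  have hKη : 0 ≤ Kη := le_max_right _ _
  have hℓ : 0 < ℓ := mollScale_pos ha S.q
  have hℓ1 : ℓ ≤ 1 := mollScale_le_one_of_params ha hb hβ hα S.q
  have hℓi : 0 ≤ ℓ⁻¹ := inv_nonneg.2 hℓ.le
  have hℓi1 : 1 ≤ ℓ⁻¹ := one_le_inv_iff₀.2 ⟨hℓ, hℓ1⟩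
  have hσ0 : 0 ≤ σ := Real.sqrt_nonneg _
  have hσ : σ ≤ Real.sqrt (amp P.β P.a P.b (S.q + 1)) / Real.sqrt c₀ := by
    rw [← Real.sqrt_div (amp_pos ha _).le]
    exact 𝒟.sqrt_rhoQ_div_etaMass_le H hc₀ ha ht
  -- the frequency `n` and `μ`
  have ha0 : 0 < P.a := by linarith
  have hn1 : 1 ≤ n := by
    rw [hndef]
    exact_mod_cast Nat.one_le_iff_ne_zero.2 (Nat.pos_iff_ne_zero.1 (Nat.ceil_pos.2 (Real.rpow_pos_of_pos ha0 _)))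
  have hn0 : 0 ≤ n := zero_le_one.trans hn1
  have hfreq : freq P.a P.b (S.q + 1) = 2 * Real.pi * n := P.freq_eq ha0.le (S.q + 1)
  have hfreqpos : 0 < freq P.a P.b (S.q + 1) := freq_pos ha _
  have hℓn : ℓ⁻¹ ≤ 2 * Real.pi * n := by
    rw [← hfreq]
    have := mul_le_mul_of_nonneg_right h66 hfreqpos.le
    rwa [mul_assoc, inv_mul_cancel₀ hfreqpos.ne', mul_one, one_mul] at this
  obtain ⟨hμ1, -, hℓμ, hASμ, hADμ, hAημ⟩ := corrFreq_mul_bounds Cη hn1 hℓi hℓn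
  have hμ0 : 0 ≤ μ := zero_le_one.trans hμ1
  have hnμ : |n| ≤ μ := by rw [abs_of_nonneg hn0]; exact (corrFreq_mul_bounds Cη hn1 hℓi hℓn).2.1
  -- smooth slices
  have hηs : IsSmooth (𝒟.cut.η i t) := (𝒟.cut.smooth i).isSmooth_slice ht
  have hRs : IsSmooth (S.Rbar t) := H.eulerReynolds.smooth_stress.isSmooth_slice ht
  have hDs : IsSmooth (𝒟.D i t) := (𝒟.flow i).smooth.isSmooth_slice ht
  -- the cut-off
  have he0 : ∀ y, |lift (𝒟.cut.η i t) y| ≤ 1 := fun y => by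
    rw [lift_apply, abs_of_nonneg (𝒟.cut.nonneg i t _)]; exact 𝒟.cut.le_one i t _
  have he1 : ∀ y, ‖iteratedFDeriv ℝ 1 (lift (𝒟.cut.η i t)) y‖ ≤ Kη := fun y =>
    𝒟.norm_iteratedFDeriv_lift_eta_le i ht (by norm_num) y
  have he2 : ∀ y, ‖iteratedFDeriv ℝ 2 (lift (𝒟.cut.η i t)) y‖ ≤ Kη * μ := fun y =>
    (𝒟.norm_iteratedFDeriv_lift_eta_le i ht le_rfl y).trans (le_mul_of_one_le_right hKη hμ1)
  -- the flow
  have hd : ∀ y, ‖iteratedFDeriv ℝ 1 (lift (𝒟.D i t)) y‖ ≤ 1 / 600 ∧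
      ‖iteratedFDeriv ℝ 2 (lift (𝒟.D i t)) y‖ ≤ ℓ⁻¹ ∧ ‖iteratedFDeriv ℝ 3 (lift (𝒟.D i t)) y‖ ≤ 2 * ℓ⁻¹ ^ 2 :=
    fun y => 𝒟.norm_iteratedFDeriv_lift_D_le H hNbar hCin ha hb hβ hα hu ht hη y
  have hd1 : ∀ y, ‖iteratedFDeriv ℝ 1 (lift (𝒟.D i t)) y‖ ≤ 1 := fun y => (hd y).1.trans (by norm_num)
  have hd2 : ∀ y, ‖iteratedFDeriv ℝ 2 (lift (𝒟.D i t)) y‖ ≤ 2 * ℓ⁻¹ := fun y => (hd y).2.1.trans (by linarith)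
  have hd3 : ∀ y, ‖iteratedFDeriv ℝ 3 (lift (𝒟.D i t)) y‖ ≤ 2 * ℓ⁻¹ * μ := fun y =>
    (hd y).2.2.trans (by rw [pow_two, ← mul_assoc]; exact mul_le_mul_of_nonneg_left hℓμ (by positivity))
  -- the stress
  have hcr : ∀ k : ℕ, k ≤ 2 → ∀ y, |c| * ‖ofColsCL‖ * ‖iteratedFDeriv ℝ k (lift (S.Rbar t)) y‖ ≤ ℓ⁻¹ ^ k :=
    fun k hk y => 𝒟.abs_c_mul_norm_iteratedFDeriv_lift_Rbar_le H hCin ha h4 hstr (hk.trans hNbar) ht y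
  have hr0 : ∀ y, |c| * ‖ofColsCL‖ * ‖lift (S.Rbar t) y‖ ≤ 1 := fun y => by
    have := hcr 0 (by norm_num) y
    rwa [norm_iteratedFDeriv_zero, pow_zero] at this
  have hst : ∀ y, ‖iteratedFDeriv ℝ 1 (stressCL c (S.Rbar t) (𝒟.D i t)) y‖ ≤ 32 * θ * ℓ⁻¹ ∧
      ‖iteratedFDeriv ℝ 2 (stressCL c (S.Rbar t) (𝒟.D i t)) y‖ ≤ 32 * θ * ℓ⁻¹ * μ := by
    intro y
    obtain ⟨h1, h2⟩ := norm_iteratedFDeriv_stressCL_le c hRs hDs y (hd1 y) (hr0 y)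
    have e1 := hcr 1 (by norm_num) y
    have e2 := hcr 2 le_rfl y
    rw [pow_one] at e1
    obtain ⟨-, f2, f3⟩ := hd y
    obtain ⟨a1, a2⟩ := stress_orders_arith (θ := θ) hθ (norm_nonneg _) hℓi f2 f3 e1 e2 hℓμ
    exact ⟨h1.trans a1, h2.trans a2⟩
  -- confinement in the carrier
  have hK : ∀ y, stressCL c (S.Rbar t) (𝒟.D i t) y ∈ Metric.closedBall (1 : 𝕃) (3 + 4 * ‖transposeCL‖) := fun y => by
    rw [Metric.mem_closedBall, dist_eq_norm, ← hθdef]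
    refine (norm_stressCL_sub_one_le c (S.Rbar t) (𝒟.D i t) y (hd1 y)).trans ?_
    rw [← hθdef]
    have f1 := (hd y).1
    have g0 := hr0 y
    have hθ1 : 0 ≤ 1 + 2 * θ := by linarith only [hθ]
    have hθ2 : 0 ≤ 2 * (1 + θ) := by linarith only [hθ]
    have k1 := mul_le_mul_of_nonneg_left f1 hθ1
    have k2 := mul_le_mul_of_nonneg_left g0 hθ2
    linarith only [k1, k2, hθ]
  -- the abstract envelope
  have key := hasEnvelope_slowDeriv (V := 𝔚.V) (σ := σ) (c := c) (n := n) (ηsl := 𝒟.cut.η i t)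
    (Rsl := S.Rbar t) (Dsl := 𝒟.D i t) 𝔚.contDiff_mikadoLift_V hCV0 hCV hσ0 hμ1 hnμ hKη hAημ
    (by positivity : (0 : ℝ) ≤ 2 * ℓ⁻¹) hADμ (by positivity : (0 : ℝ) ≤ 32 * θ * ℓ⁻¹) hASμ hηs hRs hDs
    he0 he1 he2 hd1 hd2 hd3 hK (fun y => (hst y).1) (fun y => (hst y).2)
  -- compare the amplitudes
  have hamp := corrAmp_mul_bound Cη (c₀ := c₀) (L := ℓ⁻¹) hCV0 (Real.sqrt_nonneg _) hσ hℓi1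
  exact key.mono le_rfl hamp

end SlowPartEnvelope

section Counting

variable {P : Params} {S : Setting} {𝔚 : MikadoDatum mikadoRadius} {η : ℕ → ℝ → 𝕋³ → ℝ}
  {D : ℕ → ℝ → 𝕋³ → ℝ³} {i : ℕ} {t : ℝ}

end Counting

section Discharge

/-- **BDSV Cor. 5.8, (5.30)** (the corrector bound): along the common prefix of the stage facts,
`‖w_c‖₀ ≤ C δ_{q+1}^{1/2} ℓ⁻¹ λ_{q+1}⁻¹` and `[w_c]₁ ≤ C δ_{q+1}^{1/2} ℓ⁻¹` on `[0,T] × T³` for the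
corrector `w_c = w_{q+1} - w_o` of the tree's construction. Proof: `w_c = n⁻¹∑ᵢ BDSV.curl[slowPartᵢ]`
(`BDSV.correctorPart_proj`, the tree's (5.27)), the two-scale envelope of the slow parts
(`PerturbationData.hasEnvelope_slowPart`: amplitude `≲ δ_{q+1}^{1/2}ℓ⁻¹` from Lemma 5.4, (2.20),
App. B and the Mikado bounds on the stress ball; one derivative costs `≲ λ_{q+1}` by (6.6)), at most
two active cut-offs, and `λ_{q+1} = 2πn_{q+1}`. Thresholds: `α < min(βb(b-1), (1-β)(b-1)/3)`, `N̄ = 2`,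
`a` beyond the thresholds of `4δ_{q+2} ≤ δ_{q+1}λ_q^{-α}`, `C_inℓ^{2α} ≤ 1/2400`,
`8‖ofCols‖C_inλ_q^αℓ^α ≤ 1`, `8C_inλ_q^αℓ^α ≤ 1/100` and (6.6).
[cite: BuckmasterEtAl2018, Cor. 5.8 (arXiv (5.30))] -/
theorem correctorPartBound_holds : correctorPartBound := by
  intro 𝔚 c₀ hc₀ Cη β hβ hβ3 b hb hb'
  have hb0 : 0 < b := by linarith
  have hb1 : 0 < b - 1 := by linarith
  have h1β : 0 < 1 - β := by linarith
  refine ⟨min (β * b * (b - 1)) ((1 - β) * (b - 1) / 3),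
    lt_min (mul_pos (mul_pos hβ hb0) hb1) (div_pos (mul_pos h1β hb1) (by norm_num)), fun α hα hαlt => ?_⟩
  have hαb : α < 2 * β * b * (b - 1) := by
    have := lt_of_lt_of_le hαlt (min_le_left _ _); nlinarith [mul_pos hβ hb0]
  have hα66 : 3 * α < 2 * (1 - β) * (b - 1) := by
    have := lt_of_lt_of_le hαlt (min_le_right _ _); nlinarith [mul_pos h1β hb1]
  refine ⟨2, fun Cin C₀ => ?_⟩
  set Cp : ℝ := max Cin 0 with hCp
  have hCp0 : 0 ≤ Cp := le_max_right _ _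
  -- the Mikado bound on the stress ball
  obtain ⟨CV, hCV0, hCV⟩ := exists_forall_le_norm_iteratedFDeriv_mikadoLiftCL_le 𝔚.contDiff_mikadoLift_V
    (isCompact_closedBall (1 : 𝕃) (3 + 4 * ‖transposeCL‖)) 2
  -- thresholds in `a`
  obtain ⟨a₁, ha₁, h4⟩ := exists_threshold_four_amp hb hαb
  obtain ⟨a₂, ha₂, hu⟩ := exists_threshold_mollScale_rpow_le hβ.le hb.le hα Cp (by norm_num : (0 : ℝ) < 1 / 2400)
  obtain ⟨a₃, ha₃, hstr⟩ := exists_threshold_freq_mul_mollScale_rpow_le hβ.le hb.le hα (8 * ‖ofColsCL‖ * Cp) one_pos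
  obtain ⟨a₄, ha₄, hstr'⟩ :=
    exists_threshold_freq_mul_mollScale_rpow_le hβ.le hb.le hα (8 * Cp) (by norm_num : (0 : ℝ) < 1 / 100)
  obtain ⟨a₅, ha₅, h66⟩ := exists_threshold_mollScale_inv_mul_freq_inv_le_one hb.le hα66
  -- the constant
  set Acst : ℝ :=
    (‖transposeCL‖ * CV * (16 * (32 * ‖transposeCL‖) + 4 * 2 + 8 * max (Cη 0 2) 0) / Real.sqrt c₀) with hAcst
  set Fcst : ℝ := (2 * Real.pi * (32 * ‖transposeCL‖ + 3) + max (Cη 0 2) 0 + 1) with hFcst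
  have hA0 : 0 ≤ Acst := corrAmp_nonneg Cη c₀ hCV0
  have hF1 : 1 ≤ Fcst := one_le_corrFreq Cη
  have hF0 : 0 ≤ Fcst := zero_le_one.trans hF1
  have hcurl : 0 ≤ ‖curlCLM‖ := norm_nonneg _
  have hπ1 : 1 ≤ Real.pi := by linarith [Real.two_le_pi]
  have hπ0 : 0 ≤ Real.pi := zero_le_one.trans hπ1
  set K : ℝ := 4 * Real.pi * ‖curlCLM‖ * Acst * Fcst with hKdef
  have hK₁ : 4 * Real.pi * ‖curlCLM‖ * Acst ≤ K := by
    rw [hKdef]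
    exact le_mul_of_one_le_right (mul_nonneg (mul_nonneg (mul_nonneg (by norm_num) hπ0) hcurl) hA0) hF1
  have hK₂ : 4 * ‖curlCLM‖ * Acst * Fcst ≤ K := by
    rw [hKdef]
    have h0 : 0 ≤ 4 * ‖curlCLM‖ * Acst * Fcst := mul_nonneg (mul_nonneg (mul_nonneg (by norm_num) hcurl) hA0) hF0
    calc 4 * ‖curlCLM‖ * Acst * Fcst = 1 * (4 * ‖curlCLM‖ * Acst * Fcst) := (one_mul _).symm
      _ ≤ Real.pi * (4 * ‖curlCLM‖ * Acst * Fcst) := mul_le_mul_of_nonneg_right hπ1 h0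
      _ = 4 * Real.pi * ‖curlCLM‖ * Acst * Fcst := by ring
  refine ⟨K, max a₁ (max a₂ (max a₃ (max a₄ a₅))), lt_max_of_lt_left ha₁, fun a ha S H 𝒟 => ?_⟩
  have haa₁ : a₁ ≤ a := (le_max_left _ _).trans ha
  have haa₂ : a₂ ≤ a := ((le_max_left _ _).trans (le_max_right _ _)).trans ha
  have haa₃ : a₃ ≤ a := (((le_max_left _ _).trans (le_max_right _ _)).trans (le_max_right _ _)).trans ha
  have haa₄ : a₄ ≤ a :=
    ((((le_max_left _ _).trans (le_max_right _ _)).trans (le_max_right _ _)).trans (le_max_right _ _)).trans ha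
  have haa₅ : a₅ ≤ a :=
    ((((le_max_right _ _).trans (le_max_right _ _)).trans (le_max_right _ _)).trans (le_max_right _ _)).trans ha
  have ha1 : (1 : ℝ) ≤ a := ha₁.le.trans haa₁
  have ha0 : (0 : ℝ) < a := by linarith
  have H' : CoreHypotheses ⟨β, α, a, b⟩ S 2 Cp C₀ := H.mono_const ha1 (le_max_left _ _)
  -- the parameter inequalities at this `a`
  have h4' : 4 * amp β a b (S.q + 2) ≤ amp β a b (S.q + 1) * freq a b S.q ^ (-α) := h4 a haa₁ S.q
  have hu' : Cp * mollScale β α a b S.q ^ (2 * α) ≤ 1 / 2400 := hu a haa₂ S.q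
  have hstr₁ : 8 * ‖ofColsCL‖ * Cp * (freq a b S.q ^ α * mollScale β α a b S.q ^ α) ≤ 1 := hstr a haa₃ S.q
  have hstr₂ : 8 * (Cp * (freq a b S.q ^ α * mollScale β α a b S.q ^ α)) ≤ 1 / 100 := by
    have := hstr' a haa₄ S.q; linarith
  have h66' : (mollScale β α a b S.q)⁻¹ * (freq a b (S.q + 1))⁻¹ ≤ 1 := h66 a haa₅ S.q
  have hdef : Real.exp (4 * (Cp * mollScale β α a b S.q ^ (2 * α))) - 1 ≤ 1 / 300 := by
    have hx0 : 0 ≤ 4 * (Cp * mollScale β α a b S.q ^ (2 * α)) :=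
      mul_nonneg (by norm_num) (mul_nonneg hCp0 (Real.rpow_nonneg (mollScale_pos ha1 _).le _))
    have hx : |4 * (Cp * mollScale β α a b S.q ^ (2 * α))| ≤ 1 := by rw [abs_of_nonneg hx0]; linarith
    have h := Real.abs_exp_sub_one_le hx
    rw [abs_of_nonneg hx0] at h
    linarith [le_abs_self (Real.exp (4 * (Cp * mollScale β α a b S.q ^ (2 * α))) - 1)]
  -- scales
  set ℓ := mollScale β α a b S.q with hℓdef
  set n : ℝ := (Params.freqNat ⟨β, α, a, b⟩ (S.q + 1) : ℝ) with hndef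
  have hℓ : 0 < ℓ := mollScale_pos ha1 S.q
  have hn1 : 1 ≤ n := by
    rw [hndef]
    exact_mod_cast Nat.one_le_iff_ne_zero.2 (Nat.pos_iff_ne_zero.1 (Nat.ceil_pos.2 (Real.rpow_pos_of_pos ha0 _)))
  have hn0 : 0 < n := by linarith
  have hnne : Params.freqNat ⟨β, α, a, b⟩ (S.q + 1) ≠ 0 := by
    intro h; rw [hndef, h, Nat.cast_zero] at hn1; linarith
  have hfreq : freq a b (S.q + 1) = 2 * Real.pi * n := Params.freq_eq ⟨β, α, a, b⟩ ha0.le (S.q + 1)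
  have hninv : n⁻¹ = 2 * Real.pi * (freq a b (S.q + 1))⁻¹ := by
    rw [hfreq, mul_inv, mul_inv]; field_simp
  set E : ℝ := Acst * Real.sqrt (amp β a b (S.q + 1)) * ℓ⁻¹ with hEdef
  set ν : ℝ := 2 * (Fcst * n) with hνdef
  have hE0 : 0 ≤ E := mul_nonneg (mul_nonneg hA0 (Real.sqrt_nonneg _)) (inv_nonneg.2 hℓ.le)
  have hν0 : 0 ≤ ν := mul_nonneg (by norm_num) (mul_nonneg hF0 hn0.le)
  have hτ : 0 < Params.τ ⟨β, α, a, b⟩ S.q := glueScale_pos ha1 S.q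
  -- pointwise consequences at a time `t ∈ [0,T]`
  have main : ∀ t ∈ Icc 0 S.T, ∀ y : ℝ³,
      (∑ i ∈ Finset.range (cutoffCount S.T (Params.τ ⟨β, α, a, b⟩ S.q)),
          ‖slowPart ⟨β, α, a, b⟩ S 𝔚 𝒟.cut.η 𝒟.D i t y‖ ≤ 2 * E) ∧
      (∑ i ∈ Finset.range (cutoffCount S.T (Params.τ ⟨β, α, a, b⟩ S.q)),
          ‖fderiv ℝ (slowPart ⟨β, α, a, b⟩ S 𝔚 𝒟.cut.η 𝒟.D i t) y‖ ≤ 2 * (E * ν)) := by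
    intro t ht y
    -- per-index bounds
    have hind : ∀ i, ‖slowPart ⟨β, α, a, b⟩ S 𝔚 𝒟.cut.η 𝒟.D i t y‖ ≤ E ∧
        ‖fderiv ℝ (slowPart ⟨β, α, a, b⟩ S 𝔚 𝒟.cut.η 𝒟.D i t) y‖ ≤ E * ν := by
      intro i
      by_cases hact : ∃ x', 𝒟.cut.η i t x' ≠ 0
      · obtain ⟨x', hx'⟩ := hact
        have henv := 𝒟.hasEnvelope_slowPart H' 𝔚 le_rfl hc₀ hCp0 ha1 hb.le hβ.le hα.le h4' hu' hstr₁ h66'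
          hCV0 hCV ht hx'
        refine ⟨henv.norm_le₀ y, ?_⟩
        have h1 := henv.norm_le le_rfl y
        rwa [norm_iteratedFDeriv_one_eq_norm_fderiv, pow_one] at h1
      · push Not at hact
        have hz := slowPart_eq_zero_of_eta_eq_zero (P := ⟨β, α, a, b⟩) (S := S) (𝔚 := 𝔚) (D := 𝒟.D)
          (𝒟.cut.nonneg i t) hact
        rw [hz]
        simp only [fderiv_const_apply, norm_zero]
        exact ⟨hE0, mul_nonneg hE0 hν0⟩
    have hz0 : ∀ i, (∀ x, 𝒟.cut.η i t x = 0) → ‖slowPart ⟨β, α, a, b⟩ S 𝔚 𝒟.cut.η 𝒟.D i t y‖ = 0 :=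
      fun i hi => by
        rw [slowPart_eq_zero_of_eta_eq_zero (P := ⟨β, α, a, b⟩) (S := S) (𝔚 := 𝔚) (D := 𝒟.D)
          (𝒟.cut.nonneg i t) hi, norm_zero]
    have hz1 : ∀ i, (∀ x, 𝒟.cut.η i t x = 0) →
        ‖fderiv ℝ (slowPart ⟨β, α, a, b⟩ S 𝔚 𝒟.cut.η 𝒟.D i t) y‖ = 0 := fun i hi => by
      rw [slowPart_eq_zero_of_eta_eq_zero (P := ⟨β, α, a, b⟩) (S := S) (𝔚 := 𝔚) (D := 𝒟.D)
        (𝒟.cut.nonneg i t) hi]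
      simp only [fderiv_const_apply, norm_zero]
    exact ⟨𝒟.cut.sum_le_two_mul hτ t hE0 (fun i => (hind i).1) hz0 _,
      𝒟.cut.sum_le_two_mul hτ t (mul_nonneg hE0 hν0) (fun i => (hind i).2) hz1 _⟩
  -- hypotheses of the corrector identity at a time `t ∈ [0,T]`
  have hηs : ∀ t ∈ Icc 0 S.T, ∀ i, IsSmooth (𝒟.cut.η i t) := fun t ht i => (𝒟.cut.smooth i).isSmooth_slice ht
  have hRs : ∀ t ∈ Icc 0 S.T, IsSmooth (S.Rbar t) := fun t ht => H.eulerReynolds.smooth_stress.isSmooth_slice ht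
  have hDs : ∀ t ∈ Icc 0 S.T, ∀ i, IsSmooth (𝒟.D i t) := fun t ht i => (𝒟.flow i).smooth.isSmooth_slice ht
  have hball : ∀ t ∈ Icc 0 S.T, ∀ i x, 𝒟.cut.η i t x ≠ 0 →
      tildeR ⟨β, α, a, b⟩ S 𝒟.cut.η 𝒟.D i t x ∈ Metric.closedBall (1 : 𝕄) mikadoRadius := fun t ht i x hx =>
    𝒟.tildeR_mem_closedBall H' hCp0 ha1 hdef hstr₂ h4' ht hx x
  refine ⟨fun t ht x => ?_, fun j t ht x => ?_⟩
  · have h := norm_correctorPart_le_of_slowPart (𝔚 := 𝔚) (hηs t ht) (hRs t ht) (hDs t ht)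
      (H.eulerReynolds.symm t ht) hnne (hball t ht) (fun y => (main t ht y).1) x
    refine h.trans ?_
    have hX : 0 ≤ Real.sqrt (amp β a b (S.q + 1)) * ℓ⁻¹ * (freq a b (S.q + 1))⁻¹ :=
      mul_nonneg (mul_nonneg (Real.sqrt_nonneg _) (inv_nonneg.2 hℓ.le)) (inv_nonneg.2 (freq_pos ha1 _).le)
    calc (Params.freqNat ⟨β, α, a, b⟩ (S.q + 1) : ℝ)⁻¹ * (‖curlCLM‖ * (2 * E))
        = (4 * Real.pi * ‖curlCLM‖ * Acst) * (Real.sqrt (amp β a b (S.q + 1)) * ℓ⁻¹ * (freq a b (S.q + 1))⁻¹) := by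
          rw [← hndef, hninv, hEdef]; ring
      _ ≤ K * (Real.sqrt (amp β a b (S.q + 1)) * ℓ⁻¹ * (freq a b (S.q + 1))⁻¹) :=
          mul_le_mul_of_nonneg_right hK₁ hX
  · have h := norm_partialDeriv_correctorPart_le_of_slowPart (𝔚 := 𝔚) (hηs t ht) (hRs t ht) (hDs t ht)
      (H.eulerReynolds.symm t ht) hnne (hball t ht) (fun y => (main t ht y).2) j x
    refine h.trans ?_
    have hX : 0 ≤ Real.sqrt (amp β a b (S.q + 1)) * ℓ⁻¹ := mul_nonneg (Real.sqrt_nonneg _) (inv_nonneg.2 hℓ.le)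
    calc (Params.freqNat ⟨β, α, a, b⟩ (S.q + 1) : ℝ)⁻¹ * (‖curlCLM‖ * (2 * (E * ν)))
        = (n⁻¹ * n) * (4 * ‖curlCLM‖ * Acst * Fcst) * (Real.sqrt (amp β a b (S.q + 1)) * ℓ⁻¹) := by
          rw [← hndef, hEdef, hνdef]; ring
      _ = (4 * ‖curlCLM‖ * Acst * Fcst) * (Real.sqrt (amp β a b (S.q + 1)) * ℓ⁻¹) := by
          rw [inv_mul_cancel₀ hn0.ne', one_mul]
      _ ≤ K * (Real.sqrt (amp β a b (S.q + 1)) * ℓ⁻¹) := mul_le_mul_of_nonneg_right hK₂ hX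

end Discharge

end DeRosa

end Literature.Analysis.FluidPDE
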